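import Literature.Dynamics.Homogeneous.OrthogonalGroupOrbitClosures
import HarnessLib

/-!
# The elementary half of Verbitsky's orbit-closure trichotomy for the K3 lattice:
# closed orbits of rational planes, and persistence of a rational line in orbit closures

Topic `Literature/Dynamics/Homogeneous`; theorems only (no new notion, no named fact, D-0026), on top
of `OrthogonalGroupOrbitClosures` (the named fact
`Literature.Dynamics.Homogeneous.Verbitsky2017_orbitClosure_trichotomy_K3`) and of the K3 lattice
files (`k3Gram`, `k3PeriodDomain`, the real form `Matrix.toBilin' (k3Gram.map Int.cast)` with its
API `k3RForm_apply`, `k3RForm_comm`, `mem_k3PeriodDomain_iff_k3RForm`, `twistorChain_comb2`).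

Source (held text `paper:arxiv-1708.05802`, pp. 3–4, read by the proving seat): M. Verbitsky,
*Ergodic complex structures on hyperkähler manifolds: an erratum*, §2.3, Theorem: for an integral
lattice of signature `(a,b)`, `a > 2`, `b > 0`, `a + b > 4`, `Γ ⊂ SO(V_ℤ)` of finite index and
`l ∈ Gr₊₊(V)`: "(i) `Γ l` is closed. This happens when the 2-plane `l ⊂ V` is rational. (ii) `Γ l`
is dense in `Gr₊₊(V)`. This happens when `l` contains no rational vectors. (iii) The closure
`cl(Γ l)` is the set of all 2-planes `V₁ ∈ Gr₊₊(V)` containing a 1-dimensional rational subspace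
`v ⊂ V_ℚ`." The printed proof (p. 4) obtains all three cases at once from Ratner's orbit-closure
theorem for the unipotent-generated `H = SO⁺(a−2,b)` acting on `SO⁺(a,b)/Γ` (§2.2) and the list of
intermediate subgroups `SO⁺(a−2,b) ⊂ SO⁺(a−1,b) ⊂ SO⁺(a,b)` (§2.1).

## What is proved here (unconditionally), and how

The tree renders the theorem for `Λ_{K3}` (signature `(3,19)`) as four conjuncts on period vectors
`x ∈ D = k3PeriodDomain` and the cone `{t • g x | g ∈ SO(Λ), t ≠ 0}` representing `Γ[x]`. Two of
them are INCLUSIONS that use nothing but the discreteness of `Λ = ℤ²² ⊂ Λ_ℝ`; they are proved here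
by an elementary finiteness argument (a deviation from the printed proof, which does not separate
them from the Ratner-theoretic density statements):

* `mem_orbit_of_rationalPlane_of_mem_closure` — conjunct (i): if the positive plane
  `P_x = ⟨Re x, Im x⟩` is rational, every period vector in the closure of the cone of `x` lies in
  the cone (the orbit `Γ[x]` is closed in `Per`);
* `exists_latticeVector_of_mem_closure_orbit` — the second half of conjunct (iii): if `P_x`
  contains a non-zero lattice vector, so does the plane of every period vector in the closure of
  the cone of `x`;
* `Verbitsky2017_orbitClosure_trichotomy_K3_of_dense` — the named fact follows from its two
  DENSITY conjuncts ((ii): no rational vector in `P_x` ⇒ the cone is dense in `D`; (iii), first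
  half: every period vector whose plane contains the rational vector `v ∈ P_x` is in the closure),
  which are the genuinely Ratner-theoretic content (Ratner's theorem, Borel density and the
  Lie-algebra classification `𝔰𝔬(1,19) ⊊ 𝔤 ⊊ 𝔰𝔬(3,19)` are not in Mathlib) and are NOT proved here.

Appended (same seat): `exists_orbit_latticeVector_of_mem_closure_orbit` — the orbit form
`cl(Γ l) ⊆ Γ · Gr₊₊(v)` of (iii)(b) (the lattice vector found in the limit plane is `g v`,
`g ∈ SO(Λ)`); `smul_map_mulVec_mem_closure_orbit` — the closure of the cone is
`SO(Λ) × ℂˣ`-invariant (so the rendered `Gr₊₊(v) ⊆ closure` is the printed `Γ · Gr₊₊(v) ⊆ closure`);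
`eq_smul_or_eq_smul_star_of_re_im` — period vectors with a common plane differ by a scalar
(same orientation) or a scalar and conjugation (Huybrechts Ch. 6 Prop. 1.5, `D/ℂˣ ≅ Gr₊₊`);
`exists_smul_eq_smul_of_not_rationalPlane` — in the intermediate case the lattice vectors of the
plane are commensurable with `v` (`dim_ℚ (l ∩ V_ℚ) = 1`, §1.1); and
`mem_closure_orbit_of_stabilizer_orbit_dense` — the reduction of (iii)(a) at `v` to the density of
the `Γ_v = Stab_{SO(Λ)}(v)`-orbit of every lattice-free direction `w₀ ⊥ v` in the sphere
`{w ⊥ v | (w.w) = (w₀.w₀)}` (the intermediate subgroup `Stab(v) = SO⁺(a−1,b)` of the printed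
proof; this orbit density is the remaining Ratner-theoretic input for (iii)(a)); finally
`Verbitsky2017_orbitClosure_trichotomy_K3_of_planeDense_of_stabilizerDense` assembles the named
fact from exactly these two inputs — (ii) and the stabiliser-orbit density for every `v ≠ 0`.
CORRECTION (appended): asked for EVERY `v ≠ 0` the stabiliser-orbit density is false — for an
ISOTROPIC `v` the stabiliser is not reductive and the orbit of `w₀ = e' + f' + √2 e` under `Γ_e`
(`e ∈ U₁`, `e', f' ∈ U₂`) stays in the closed set `ℤ²² + √2 e`
(`exists_isotropic_stabilizer_orbit_not_dense`, `not_forall_stabilizer_orbit_dense`), so that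
assembly is vacuous; `Verbitsky2017_orbitClosure_trichotomy_K3_of_planeDense_of_posStabilizerDense`
asks it only for `(v.v) > 0` (a lattice vector of a positive plane has positive square,
`k3RForm_pos_of_inPlane`), where it is the orbit-closure dichotomy for the maximal connected
subgroup `SO⁺(1,19) = Stab(v,w₀)° ⊂ SO⁺(2,19) = Stab(v)°` (closed orbit iff `ℝ w₀` rational, by
Borel density; dense otherwise) — these two, (ii) and the positive-`v` stabiliser density, are
residual Ratner-theoretic inputs of `Verbitsky2017_orbitClosure_trichotomy_K3` on two different
homogeneous spaces.
ONE RESIDUAL STATEMENT (appended last): both are replaced by a single FRAME-LEVEL statement `S` on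
one homogeneous space — for `x, y ∈ D` with `(Re y)² = (Re x)²` such that every lattice vector of
`P_x` lies in `P_y` with the same coordinates, `y ∈ cl(SO(Λ)·x)` (orbit of the vector `x`, no
scalars), i.e. `cl(Γ·x) ⊇ T_x = P_x·x` for `P_x` the identity component of the pointwise
stabiliser of `P_x ∩ Λ` (`SO⁺(3,19)`, `Stab(v)°`, `SO⁺(1,19)` in the three cases) — which is
Ratner's orbit-closure theorem for `H = SO⁺(1,19)` on `SO(3,19)/SO(Λ)` with the intermediate
group identified by §2.1 and Borel density:
`Verbitsky2017_orbitClosure_trichotomy_K3_of_frameOrbitClosure : S → fact`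
(`dense_of_frameOrbitClosure` gives (ii) by rescaling the target, `mem_closure_orbit_of_frameOrbitClosure`
gives (iii)(a) by normalising both frames to `v + i w` and commensurability;
`frameOrbitClosure_of_rationalPlane`: `S` is unconditionally true at rational planes). Conversely
and UNCONDITIONALLY `cl(Γ·x) ⊆ Γ·T_x` (`exists_orbit_frame_of_mem_closure_orbit`,
`mem_k3PeriodDomain_of_mem_closure_orbit`: discreteness again), so that under `S` the orbit
closure is exactly `Γ·T_x` (`closure_orbit_eq_of_frameOrbitClosure`) and `S` is EQUIVALENT to the
orbit-closure formula `cl(Γ·x) = Γ·T_x` for all `x ∈ D` (`frameOrbitClosure_iff_closure_orbit_eq`).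
`S` is not proved here (Ratner 1991, Borel–Harish-Chandra, Borel density, Lie correspondence).

The argument. Let `y_k = t_k g_k x → y` with `y ∈ D`. An integral isometry preserves the real form
(`k3RForm_mulVec_mulVec`), `Re (g x) = g (Re x)`, `Im (g x) = g (Im x)` (`re_map_mulVec`,
`im_map_mulVec`), so the cone lies in `D` (`smul_map_mulVec_mem_k3PeriodDomain`) and a lattice
vector `v = α Re x + β Im x` of `P_x` is carried to the lattice vector `g_k v` of the plane
`P_{y_k}` (`exists_inPlane_mulVec`), of the same length `(g_k v)² = v²`. Since `(Re y_k, Im y_k)`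
is an orthogonal basis of `P_{y_k}` with `(Re y_k)² = (Im y_k)² → (Re y)² > 0`, a lattice vector
`p = a Re y_k + b Im y_k` with `p² ≤ N` has `a² + b² = p²/(Re y_k)²` bounded, hence bounded integer
entries (`eventually_latticeVector_mem_Icc`); by pigeonhole (`exists_frequently_eq_of_eventually_mem`)
`g_k v` takes one value `w` for infinitely many `k`, and membership of the FIXED vector `w` in
`P_{y_k}` is the polynomial identity `(Re y_k)² w = (w.Re y_k) Re y_k + (w.Im y_k) Im y_k`, which
passes to the limit (`exists_inPlane_of_frequently`). This gives (iii)(b). For (i), `P_x` has a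
lattice basis `u, w` (the `2 × 2` matrix expressing `Re x, Im x` in `u, w` is invertible,
`exists_inPlane_of_rationalPlane`); the pair `(g_k u, g_k w)` is infinitely often a fixed pair,
along those `k` the vector `g_k x = (a g_k u + b g_k w) + i (c g_k u + d g_k w)` is a fixed
`ξ = g_K x` (`map_mulVec_eq_of_rationalPlane`), so `y_k ∈ ℂ ξ` infinitely often, `ℂ ξ` is closed,
`y = s ξ = s g_K x` and `s ≠ 0` because `y ∈ D`.

Deliberately NOT here: the density statements (ii) and (iii)(a) (equivalently the frame statement
`S`); Grassmannians as spaces; general lattices `V_ℤ` and finite-index `Γ` (the fact's own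
`TODO(general form)`).

STATUS OF `S` (sibling files `OrthogonalGroupOrbitClosures*`): the Ratner-theoretic proof of the
frame statement is carried out in `…Subalgebras` (erratum §2.1: the Lie subalgebras between
`𝔰𝔬(P_x^⊥)` and `𝔰𝔬(3,19)`), `…Unipotents` / `…K3Plane` (§2.2: `H` generated by unipotents; fixed
vectors and centralizers of the isotropic wedges), `…FixedSpaces` / `…Commutant` (rationality of
planes and lines from Borel-density outputs), `…Transvections` (transitivity on frames by Eichler
transvections), `…FrameRotation`, and assembled in `…RatnerReduction`:
`Verbitsky2017_orbitClosure_trichotomy_K3_of_ratnerGroup` proves the fact from the bare outputs of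
Ratner's orbit-closure theorem, Borel–Harish-Chandra, the Lie correspondence and the Borel density
theorem for the frame stabiliser `H° = SO⁺(P_x^⊥)` — the four classical inputs, absent from Mathlib
and `Literature/`, that separate `S` (and `_holds`) from a proof.

## References

* [Verbitsky2017ErgodicErratum] M. Verbitsky, Ergodic complex structures on hyperkähler manifolds:
  an erratum, arXiv:1708.05802 (2017), §2.3 Theorem (i)–(iii), §2.1, §2.2.
* [Verbitsky2015Ergodic] M. Verbitsky, Ergodic complex structures on hyperkähler manifolds, Acta
  Math. 215 (2015), Thm. 4.8 (as corrected by the erratum).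
* [Huybrechts2016K3] D. Huybrechts, Lectures on K3 Surfaces, CUP 2016, Ch. 6 Prop. 1.5 (the period
  domain as the Grassmannian of oriented positive planes).
-/

noncomputable section

open scoped Matrix
open _root_.Filter _root_.Topology
open Literature.AlgebraicGeometry Literature.AlgebraicGeometry.Surfaces

namespace Literature.Dynamics.Homogeneous

/-! ### Integral isometries of `Λ_{K3}`: the real form, real and imaginary parts, the cone in `D` -/

/-- An integral isometry `g` of `Λ_{K3}` (`gᵀ Λ g = Λ`) preserves the real form `(u.w) = uᵀ Λ w`
on `Λ_ℝ`: `(g u . g w) = (u.w)`. [folklore] -/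
theorem k3RForm_mulVec_mulVec {B : LinearMap.BilinForm ℝ (K3Index → ℝ)}
    (hB : B = Matrix.toBilin' (k3Gram.map (Int.cast : ℤ → ℝ)))
    {g : Matrix K3Index K3Index ℤ} (hg : g.transpose * k3Gram * g = k3Gram) (u w : K3Index → ℝ) :
    B (g.map (Int.cast : ℤ → ℝ) *ᵥ u) (g.map (Int.cast : ℤ → ℝ) *ᵥ w) = B u w := by
  subst hB
  have hR : (g.map (Int.cast : ℤ → ℝ)).transpose * (k3Gram.map (Int.cast : ℤ → ℝ) *
      g.map (Int.cast : ℤ → ℝ)) = k3Gram.map (Int.cast : ℤ → ℝ) := by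
    have h := congrArg (fun M : Matrix K3Index K3Index ℤ => M.map (Int.castRingHom ℝ)) hg
    simp only [Matrix.map_mul, Matrix.transpose_map] at h
    simpa [Matrix.mul_assoc] using h
  rw [Matrix.toBilin'_apply', Matrix.toBilin'_apply', Matrix.mulVec_mulVec,
    ← Matrix.vecMul_transpose (g.map (Int.cast : ℤ → ℝ)) u, ← Matrix.dotProduct_mulVec,
    Matrix.mulVec_mulVec, hR]

/-- For an integral matrix `g` and a lattice vector `v`, the real vector of `g v` is `g` applied to
the real vector of `v`. [folklore] -/
theorem intCast_mulVec_apply (g : Matrix K3Index K3Index ℤ) (v : K3Index → ℤ) (i : K3Index) :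
    (((g *ᵥ v) i : ℤ) : ℝ) = (g.map (Int.cast : ℤ → ℝ) *ᵥ fun j => (v j : ℝ)) i := by
  simp [Matrix.mulVec, dotProduct]

/-- Real part of `g x` for an integral matrix `g`: `Re (g x) = g (Re x)`. [folklore] -/
theorem re_map_mulVec (g : Matrix K3Index K3Index ℤ) (x : K3Index → ℂ) (i : K3Index) :
    ((g.map (Int.cast : ℤ → ℂ) *ᵥ x) i).re =
      (g.map (Int.cast : ℤ → ℝ) *ᵥ fun j => (x j).re) i := by
  simp [Matrix.mulVec, dotProduct, Complex.re_sum]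

/-- Imaginary part of `g x` for an integral matrix `g`: `Im (g x) = g (Im x)`. [folklore] -/
theorem im_map_mulVec (g : Matrix K3Index K3Index ℤ) (x : K3Index → ℂ) (i : K3Index) :
    ((g.map (Int.cast : ℤ → ℂ) *ᵥ x) i).im =
      (g.map (Int.cast : ℤ → ℝ) *ᵥ fun j => (x j).im) i := by
  simp [Matrix.mulVec, dotProduct, Complex.im_sum]

/-- Real part of a point `t • g x` of the cone: `Re (t g x) = Re t · g (Re x) − Im t · g (Im x)`.
[folklore] -/
theorem re_smul_map_mulVec (g : Matrix K3Index K3Index ℤ) (x : K3Index → ℂ) (t : ℂ)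
    (i : K3Index) :
    ((t • (g.map (Int.cast : ℤ → ℂ) *ᵥ x)) i).re =
      t.re * (g.map (Int.cast : ℤ → ℝ) *ᵥ fun j => (x j).re) i -
        t.im * (g.map (Int.cast : ℤ → ℝ) *ᵥ fun j => (x j).im) i := by
  simp only [Pi.smul_apply, smul_eq_mul, Complex.mul_re, re_map_mulVec, im_map_mulVec]

/-- Imaginary part of a point `t • g x` of the cone:
`Im (t g x) = Re t · g (Im x) + Im t · g (Re x)`. [folklore] -/
theorem im_smul_map_mulVec (g : Matrix K3Index K3Index ℤ) (x : K3Index → ℂ) (t : ℂ)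
    (i : K3Index) :
    ((t • (g.map (Int.cast : ℤ → ℂ) *ᵥ x)) i).im =
      t.re * (g.map (Int.cast : ℤ → ℝ) *ᵥ fun j => (x j).im) i +
        t.im * (g.map (Int.cast : ℤ → ℝ) *ᵥ fun j => (x j).re) i := by
  simp only [Pi.smul_apply, smul_eq_mul, Complex.mul_im, re_map_mulVec, im_map_mulVec]

/-- **The cone of a period vector lies in the period domain**: for `x ∈ D`, an integral isometry
`g` of `Λ_{K3}` and `t ≠ 0`, the vector `t • g x` is again a period point (`(g x . g x) = 0`,
`(t y . t y) = t² (y.y)`, `(t̄ ȳ . t y) = |t|² (ȳ.y)`; here via real and imaginary parts,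
Huybrechts Ch. 6 Prop. 1.5). [cite: Huybrechts2016K3, Ch. 6 §1.1 and Prop. 1.5] -/
theorem smul_map_mulVec_mem_k3PeriodDomain {x : K3Index → ℂ} (hx : x ∈ k3PeriodDomain)
    {g : Matrix K3Index K3Index ℤ} (hg : g.transpose * k3Gram * g = k3Gram) {t : ℂ} (ht : t ≠ 0) :
    t • (g.map (Int.cast : ℤ → ℂ) *ᵥ x) ∈ k3PeriodDomain := by
  set B := Matrix.toBilin' (k3Gram.map (Int.cast : ℤ → ℝ)) with hB
  obtain ⟨h12, h11, hpos⟩ := (mem_k3PeriodDomain_iff_k3RForm hB x).1 hx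
  have hpr : B (g.map (Int.cast : ℤ → ℝ) *ᵥ fun j => (x j).re)
      (g.map (Int.cast : ℤ → ℝ) *ᵥ fun j => (x j).im) = 0 := by
    rw [k3RForm_mulVec_mulVec hB hg]; exact h12
  have hrp : B (g.map (Int.cast : ℤ → ℝ) *ᵥ fun j => (x j).im)
      (g.map (Int.cast : ℤ → ℝ) *ᵥ fun j => (x j).re) = 0 := by
    rw [k3RForm_mulVec_mulVec hB hg, hB, k3RForm_comm, ← hB]; exact h12
  have hpp : B (g.map (Int.cast : ℤ → ℝ) *ᵥ fun j => (x j).re)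
      (g.map (Int.cast : ℤ → ℝ) *ᵥ fun j => (x j).re) = B (fun j => (x j).re) (fun j => (x j).re) :=
    k3RForm_mulVec_mulVec hB hg _ _
  have hrr : B (g.map (Int.cast : ℤ → ℝ) *ᵥ fun j => (x j).im)
      (g.map (Int.cast : ℤ → ℝ) *ᵥ fun j => (x j).im) = B (fun j => (x j).re) (fun j => (x j).re) := by
    rw [k3RForm_mulVec_mulVec hB hg]; exact h11.symm
  have hre : (fun i => ((t • (g.map (Int.cast : ℤ → ℂ) *ᵥ x)) i).re) =
      t.re • (g.map (Int.cast : ℤ → ℝ) *ᵥ fun j => (x j).re) -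
        t.im • (g.map (Int.cast : ℤ → ℝ) *ᵥ fun j => (x j).im) := by
    funext i
    rw [re_smul_map_mulVec]
    simp only [Pi.sub_apply, Pi.smul_apply, smul_eq_mul]
  have him : (fun i => ((t • (g.map (Int.cast : ℤ → ℂ) *ᵥ x)) i).im) =
      t.re • (g.map (Int.cast : ℤ → ℝ) *ᵥ fun j => (x j).im) +
        t.im • (g.map (Int.cast : ℤ → ℝ) *ᵥ fun j => (x j).re) := by
    funext i
    rw [im_smul_map_mulVec]
    simp only [Pi.add_apply, Pi.smul_apply, smul_eq_mul]
  have ht' : 0 < t.re * t.re + t.im * t.im := by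
    have h := Complex.normSq_pos.2 ht
    rwa [Complex.normSq_apply] at h
  rw [mem_k3PeriodDomain_iff_k3RForm hB, hre, him]
  simp only [LinearMap.BilinForm.add_left, LinearMap.BilinForm.add_right,
    LinearMap.BilinForm.sub_left, LinearMap.BilinForm.sub_right, LinearMap.BilinForm.smul_left,
    LinearMap.BilinForm.smul_right, hpr, hrp, hpp, hrr, mul_zero, sub_zero, zero_sub, add_zero,
    zero_add]
  refine ⟨by ring, by ring, ?_⟩
  have key : ∀ C : ℝ, t.re * (t.re * C) - t.im * -(t.im * C) = (t.re * t.re + t.im * t.im) * C :=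
    fun C => by ring
  rw [key]
  exact mul_pos ht' hpos

/-- **Transport of lattice vectors of the plane**: if the lattice vector `v` lies in the plane
`P_x = ⟨Re x, Im x⟩`, then for every integral matrix `g` and `t ≠ 0` the lattice vector `g v` lies
in the plane of `t • g x` (which is `g P_x`). [folklore] -/
theorem exists_inPlane_mulVec {x : K3Index → ℂ} {v : K3Index → ℤ} {α β : ℝ}
    (hv : ∀ i, (v i : ℝ) = α * (x i).re + β * (x i).im)
    (g : Matrix K3Index K3Index ℤ) {t : ℂ} (ht : t ≠ 0) :
    ∃ a b : ℝ, ∀ i, ((g *ᵥ v) i : ℝ) =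
      a * ((t • (g.map (Int.cast : ℤ → ℂ) *ᵥ x)) i).re +
        b * ((t • (g.map (Int.cast : ℤ → ℂ) *ᵥ x)) i).im := by
  have hst1 : (t⁻¹).re * t.re - (t⁻¹).im * t.im = 1 := by
    have h := congrArg Complex.re (inv_mul_cancel₀ ht)
    simpa [Complex.mul_re] using h
  have hst2 : (t⁻¹).re * t.im + (t⁻¹).im * t.re = 0 := by
    have h := congrArg Complex.im (inv_mul_cancel₀ ht)
    simpa [Complex.mul_im] using h
  refine ⟨α * (t⁻¹).re + β * (t⁻¹).im, β * (t⁻¹).re - α * (t⁻¹).im, fun i => ?_⟩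
  have hvR : (fun j => (v j : ℝ)) = α • (fun j => (x j).re) + β • (fun j => (x j).im) := by
    funext j
    simp [hv j]
  have hcast : ((g *ᵥ v) i : ℝ) =
      α * (g.map (Int.cast : ℤ → ℝ) *ᵥ fun j => (x j).re) i +
        β * (g.map (Int.cast : ℤ → ℝ) *ᵥ fun j => (x j).im) i := by
    rw [intCast_mulVec_apply, hvR, Matrix.mulVec_add, Matrix.mulVec_smul, Matrix.mulVec_smul]
    simp only [Pi.add_apply, Pi.smul_apply, smul_eq_mul]
  rw [hcast, re_smul_map_mulVec, im_smul_map_mulVec]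
  set P := (g.map (Int.cast : ℤ → ℝ) *ᵥ fun j => (x j).re) i with hP
  set R := (g.map (Int.cast : ℤ → ℝ) *ᵥ fun j => (x j).im) i with hR
  linear_combination (-(α * P + β * R)) * hst1 + (-(β * P - α * R)) * hst2

/-- **The cone determines the lattice data linearly**: if `Re x = a u + b w` and `Im x = c u + d w`
for lattice vectors `u, w`, then `g x = (a g u + b g w) + i (c g u + d g w)` for every integral
matrix `g`. [folklore] -/
theorem map_mulVec_eq_of_rationalPlane {x : K3Index → ℂ} {u w : K3Index → ℤ} {a b c d : ℝ}
    (h : ∀ i, (x i).re = a * u i + b * w i ∧ (x i).im = c * u i + d * w i)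
    (g : Matrix K3Index K3Index ℤ) :
    g.map (Int.cast : ℤ → ℂ) *ᵥ x = fun i =>
      (((a * ((g *ᵥ u) i : ℝ) + b * ((g *ᵥ w) i : ℝ) : ℝ) : ℂ) +
        ((c * ((g *ᵥ u) i : ℝ) + d * ((g *ᵥ w) i : ℝ) : ℝ) : ℂ) * Complex.I) := by
  have hxr : (fun j => (x j).re) = a • (fun j => (u j : ℝ)) + b • (fun j => (w j : ℝ)) := by
    funext j
    simp [(h j).1]
  have hxi : (fun j => (x j).im) = c • (fun j => (u j : ℝ)) + d • (fun j => (w j : ℝ)) := by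
    funext j
    simp [(h j).2]
  funext i
  apply Complex.ext
  · rw [re_map_mulVec, hxr, Matrix.mulVec_add, Matrix.mulVec_smul, Matrix.mulVec_smul]
    simp [intCast_mulVec_apply]
  · rw [im_map_mulVec, hxi, Matrix.mulVec_add, Matrix.mulVec_smul, Matrix.mulVec_smul]
    simp [intCast_mulVec_apply]

/-- **A rational positive plane has its lattice generators in the plane**: if `x ∈ D` and
`Re x, Im x` are real combinations of two lattice vectors `u, w`, then `u` and `w` are real
combinations of `Re x, Im x` (the `2 × 2` coefficient matrix is invertible because `Re x ⊥ Im x`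
and `(Re x)² = (Im x)² > 0` make `Re x, Im x` independent). [cite: Huybrechts2016K3, Ch. 6 Prop. 1.5] -/
theorem exists_inPlane_of_rationalPlane {x : K3Index → ℂ} (hx : x ∈ k3PeriodDomain)
    {u w : K3Index → ℤ} {a b c d : ℝ}
    (h : ∀ i, (x i).re = a * u i + b * w i ∧ (x i).im = c * u i + d * w i) :
    (∃ α β : ℝ, ∀ i, (u i : ℝ) = α * (x i).re + β * (x i).im) ∧
      ∃ α β : ℝ, ∀ i, (w i : ℝ) = α * (x i).re + β * (x i).im := by
  set B := Matrix.toBilin' (k3Gram.map (Int.cast : ℤ → ℝ)) with hB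
  obtain ⟨h12, h11, hpos⟩ := (mem_k3PeriodDomain_iff_k3RForm hB x).1 hx
  have h21 : B (fun i => (x i).im) (fun i => (x i).re) = 0 := by
    rw [hB, k3RForm_comm, ← hB]; exact h12
  have hxr : (fun j => (x j).re) = a • (fun j => (u j : ℝ)) + b • (fun j => (w j : ℝ)) := by
    funext j
    simp [(h j).1]
  have hxi : (fun j => (x j).im) = c • (fun j => (u j : ℝ)) + d • (fun j => (w j : ℝ)) := by
    funext j
    simp [(h j).2]
  have V1 : d • (fun j => (x j).re) - b • (fun j => (x j).im) =
      (a * d - b * c) • (fun j => (u j : ℝ)) := by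
    rw [hxr, hxi]; module
  have V2 : a • (fun j => (x j).im) - c • (fun j => (x j).re) =
      (a * d - b * c) • (fun j => (w j : ℝ)) := by
    rw [hxr, hxi]; module
  have hΔ : a * d - b * c ≠ 0 := by
    intro hΔ
    rw [hΔ, zero_smul, sub_eq_zero] at V1 V2
    have e1 := congrArg (fun z => B z fun j => (x j).re) V1
    have e2 := congrArg (fun z => B z fun j => (x j).im) V1
    have e3 := congrArg (fun z => B z fun j => (x j).im) V2
    have e4 := congrArg (fun z => B z fun j => (x j).re) V2
    simp only [LinearMap.BilinForm.smul_left, h12, h21, mul_zero] at e1 e2 e3 e4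
    have hc0 : B (fun j => (x j).re) (fun j => (x j).re) ≠ 0 := hpos.ne'
    have hc0' : B (fun j => (x j).im) (fun j => (x j).im) ≠ 0 := by rw [← h11]; exact hpos.ne'
    have hd : d = 0 := by
      rcases mul_eq_zero.1 e1 with h' | h'
      · exact h'
      · exact absurd h' hc0
    have hb : b = 0 := by
      rcases mul_eq_zero.1 e2.symm with h' | h'
      · exact h'
      · exact absurd h' hc0'
    have ha : a = 0 := by
      rcases mul_eq_zero.1 e3 with h' | h'
      · exact h'
      · exact absurd h' hc0'
    have hxr0 : (fun j => (x j).re) = 0 := by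
      rw [hxr, ha, hb, zero_smul, zero_smul, add_zero]
    rw [hxr0] at hpos
    simp at hpos
  refine ⟨⟨d / (a * d - b * c), -b / (a * d - b * c), fun i => ?_⟩,
    ⟨-c / (a * d - b * c), a / (a * d - b * c), fun i => ?_⟩⟩
  · have hi := congrFun V1 i
    simp only [Pi.sub_apply, Pi.smul_apply, smul_eq_mul] at hi
    rw [div_mul_eq_mul_div, div_mul_eq_mul_div, ← add_div, eq_div_iff hΔ]
    linear_combination -hi
  · have hi := congrFun V2 i
    simp only [Pi.sub_apply, Pi.smul_apply, smul_eq_mul] at hi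
    rw [div_mul_eq_mul_div, div_mul_eq_mul_div, ← add_div, eq_div_iff hΔ]
    linear_combination -hi

/-- **Lattice vectors of a positive plane have positive length**: if `x ∈ D` and the non-zero
lattice vector `v` lies in `P_x = ⟨Re x, Im x⟩`, then `(v.v) > 0` (indeed
`(v.v) = (α² + β²)(Re x)²`). [cite: Huybrechts2016K3, Ch. 6 Prop. 1.5] -/
theorem k3RForm_pos_of_inPlane {B : LinearMap.BilinForm ℝ (K3Index → ℝ)}
    (hB : B = Matrix.toBilin' (k3Gram.map (Int.cast : ℤ → ℝ)))
    {x : K3Index → ℂ} (hx : x ∈ k3PeriodDomain) {v : K3Index → ℤ} (hv0 : v ≠ 0) {α β : ℝ}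
    (hv : ∀ i, (v i : ℝ) = α * (x i).re + β * (x i).im) :
    0 < B (fun i => (v i : ℝ)) (fun i => (v i : ℝ)) := by
  obtain ⟨h12, h11, hpos⟩ := (mem_k3PeriodDomain_iff_k3RForm hB x).1 hx
  have hBs : ∀ u w, B u w = B w u := fun u w => by rw [hB]; exact k3RForm_comm u w
  have hvR : (fun i => (v i : ℝ)) = α • (fun i => (x i).re) + β • (fun i => (x i).im) := by
    funext i
    simp [hv i]
  have hab : 0 < α * α + β * β := by
    by_contra hle
    have hα : α = 0 := by nlinarith [mul_self_nonneg α, mul_self_nonneg β]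
    have hβ : β = 0 := by nlinarith [mul_self_nonneg α, mul_self_nonneg β]
    apply hv0
    funext i
    have hi := hv i
    rw [hα, hβ, zero_mul, zero_mul, add_zero] at hi
    exact_mod_cast hi
  rw [hvR, twistorChain_comb2 B hBs, h12, ← h11]
  have key : α * α * B (fun i => (x i).re) (fun i => (x i).re) + 2 * α * β * 0 +
      β * β * B (fun i => (x i).re) (fun i => (x i).re) =
      (α * α + β * β) * B (fun i => (x i).re) (fun i => (x i).re) := by ring
  rw [key]
  exact mul_pos hab hpos

/-! ### Discreteness: lattice vectors in converging positive planes -/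

/-- **Pigeonhole along a filter**: a function that eventually takes values in a finite set takes
one of these values frequently. [folklore] -/
theorem exists_frequently_eq_of_eventually_mem {α β : Type*} {l : Filter α} [l.NeBot]
    {S : Set β} (hS : S.Finite) {f : α → β} (hf : ∀ᶠ k in l, f k ∈ S) :
    ∃ s ∈ S, ∃ᶠ k in l, f k = s := by
  by_contra h
  simp only [not_exists, not_and, Filter.not_frequently] at h
  have hall : ∀ᶠ k in l, ∀ s ∈ S, ¬f k = s := (Filter.eventually_all_finite hS).2 h
  obtain ⟨k, hk, hk'⟩ := (hf.and hall).exists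
  exact hk' (f k) hk rfl

/-- **Lattice vectors of bounded length in converging positive planes are bounded**: if
`y_k → y₀` in `Λ_ℂ` with `y₀` and all `y_k` period points, then, eventually in `k`, every lattice
vector `p = a Re y_k + b Im y_k` of the plane of `y_k` with `(p.p) ≤ N` has all its entries in a
fixed interval `[−m, m]` (because `(p.p) = (a² + b²)(Re y_k)²` and `(Re y_k)² → (Re y₀)² > 0`).
[folklore] -/
theorem eventually_latticeVector_mem_Icc {B : LinearMap.BilinForm ℝ (K3Index → ℝ)}
    (hB : B = Matrix.toBilin' (k3Gram.map (Int.cast : ℤ → ℝ)))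
    {α : Type*} {l : Filter α} {y : α → K3Index → ℂ} {y₀ : K3Index → ℂ}
    (hy : Tendsto y l (𝓝 y₀)) (hy₀ : y₀ ∈ k3PeriodDomain) (hyD : ∀ k, y k ∈ k3PeriodDomain)
    (N : ℝ) :
    ∃ m : ℤ, ∀ᶠ k in l, ∀ (p : K3Index → ℤ) (a b : ℝ),
      (∀ i, (p i : ℝ) = a * (y k i).re + b * (y k i).im) →
      B (fun i => (p i : ℝ)) (fun i => (p i : ℝ)) ≤ N → ∀ i, p i ∈ Set.Icc (-m) m := by
  obtain ⟨-, -, hpos⟩ := (mem_k3PeriodDomain_iff_k3RForm hB y₀).1 hy₀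
  have hBs : ∀ u w, B u w = B w u := fun u w => by rw [hB]; exact k3RForm_comm u w
  -- continuity of `z ↦ (Re z . Re z)`
  have hcont : Continuous fun z : K3Index → ℂ => B (fun i => (z i).re) (fun i => (z i).re) := by
    rw [hB]
    simp only [k3RForm_apply]
    fun_prop
  have hc : Tendsto (fun k => B (fun i => (y k i).re) (fun i => (y k i).re)) l
      (𝓝 (B (fun i => (y₀ i).re) (fun i => (y₀ i).re))) :=
    (hcont.tendsto y₀).comp hy
  have hc_ev : ∀ᶠ k in l,
      B (fun i => (y₀ i).re) (fun i => (y₀ i).re) / 2 < B (fun i => (y k i).re) (fun i => (y k i).re) :=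
    hc.eventually_const_lt (by linarith)
  have hn_ev : ∀ᶠ k in l, ‖y k‖ < ‖y₀‖ + 1 := hy.norm.eventually_lt_const (lt_add_one _)
  set c₀ := B (fun i => (y₀ i).re) (fun i => (y₀ i).re) with hc₀
  set R : ℝ := ‖y₀‖ + 1 with hR
  set A : ℝ := Real.sqrt (2 * |N| / c₀) with hA
  have hA0 : 0 ≤ A := Real.sqrt_nonneg _
  refine ⟨⌈2 * (A * R)⌉, ?_⟩
  filter_upwards [hc_ev, hn_ev] with k hck hnk p a b hp hN i
  obtain ⟨hk12, hk11, hkpos⟩ := (mem_k3PeriodDomain_iff_k3RForm hB (y k)).1 (hyD k)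
  have hpvec : (fun i => (p i : ℝ)) = a • (fun i => (y k i).re) + b • (fun i => (y k i).im) := by
    funext j
    simp [hp j]
  have hQ : B (fun i => (p i : ℝ)) (fun i => (p i : ℝ)) =
      (a * a + b * b) * B (fun i => (y k i).re) (fun i => (y k i).re) := by
    rw [hpvec, twistorChain_comb2 B hBs, hk12, ← hk11]
    ring
  have habN : (a * a + b * b) * B (fun i => (y k i).re) (fun i => (y k i).re) ≤ |N| := by
    rw [← hQ]
    exact hN.trans (le_abs_self N)
  have hab : a * a + b * b ≤ 2 * |N| / c₀ := by
    rw [le_div_iff₀ hpos]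
    nlinarith [habN, hck, mul_self_nonneg a, mul_self_nonneg b, abs_nonneg N]
  have ha : |a| ≤ A := Real.abs_le_sqrt (by nlinarith [hab, mul_self_nonneg b])
  have hb : |b| ≤ A := Real.abs_le_sqrt (by nlinarith [hab, mul_self_nonneg a])
  have hre : |(y k i).re| ≤ R :=
    (Complex.abs_re_le_norm _).trans ((norm_le_pi_norm (y k) i).trans hnk.le)
  have him : |(y k i).im| ≤ R :=
    (Complex.abs_im_le_norm _).trans ((norm_le_pi_norm (y k) i).trans hnk.le)
  have hpi : |(p i : ℝ)| ≤ 2 * (A * R) := by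
    rw [hp i]
    calc |a * (y k i).re + b * (y k i).im|
        ≤ |a * (y k i).re| + |b * (y k i).im| := abs_add_le _ _
      _ = |a| * |(y k i).re| + |b| * |(y k i).im| := by rw [abs_mul, abs_mul]
      _ ≤ A * R + A * R :=
          add_le_add (mul_le_mul ha hre (abs_nonneg _) hA0) (mul_le_mul hb him (abs_nonneg _) hA0)
      _ = 2 * (A * R) := by ring
  have hceil := Int.le_ceil (2 * (A * R))
  have h1 : ((p i : ℤ) : ℝ) ≤ (⌈2 * (A * R)⌉ : ℝ) := ((le_abs_self _).trans hpi).trans hceil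
  have h2 : (-(⌈2 * (A * R)⌉ : ℤ) : ℝ) ≤ (p i : ℝ) := by
    linarith [neg_abs_le (p i : ℝ)]
  exact ⟨by exact_mod_cast h2, by exact_mod_cast h1⟩

/-- **Membership of a fixed vector in the plane passes to the limit**: if `y_k → y₀` in `Λ_ℂ`
with `y₀` and all `y_k` period points, and a fixed real vector `w` lies in the plane of `y_k` for
`k` frequently, then `w` lies in the plane of `y₀` (the condition is the polynomial identity
`(Re y . Re y) w = (w . Re y) Re y + (w . Im y) Im y` in `y`). [folklore] -/
theorem exists_inPlane_of_frequently {α : Type*} {l : Filter α} {y : α → K3Index → ℂ}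
    {y₀ : K3Index → ℂ} (hy : Tendsto y l (𝓝 y₀)) (hy₀ : y₀ ∈ k3PeriodDomain)
    (hyD : ∀ k, y k ∈ k3PeriodDomain) (w : K3Index → ℝ)
    (hw : ∃ᶠ k in l, ∃ a b : ℝ, ∀ i, w i = a * (y k i).re + b * (y k i).im) :
    ∃ a b : ℝ, ∀ i, w i = a * (y₀ i).re + b * (y₀ i).im := by
  set B := Matrix.toBilin' (k3Gram.map (Int.cast : ℤ → ℝ)) with hB
  have hBs : ∀ u v, B u v = B v u := fun u v => by rw [hB]; exact k3RForm_comm u v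
  -- continuity of the defect map
  have hre : Continuous fun z : K3Index → ℂ => (fun i => (z i).re) :=
    continuous_pi fun i => Complex.continuous_re.comp (continuous_apply i)
  have him : Continuous fun z : K3Index → ℂ => (fun i => (z i).im) :=
    continuous_pi fun i => Complex.continuous_im.comp (continuous_apply i)
  have h1 : Continuous fun z : K3Index → ℂ => B (fun i => (z i).re) (fun i => (z i).re) := by
    rw [hB]
    simp only [k3RForm_apply]
    fun_prop
  have h2 : Continuous fun z : K3Index → ℂ => B w (fun i => (z i).re) := by
    rw [hB]
    simp only [k3RForm_apply]
    fun_prop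
  have h3 : Continuous fun z : K3Index → ℂ => B w (fun i => (z i).im) := by
    rw [hB]
    simp only [k3RForm_apply]
    fun_prop
  have hG : Continuous fun z : K3Index → ℂ =>
      B (fun i => (z i).re) (fun i => (z i).re) • w -
        B w (fun i => (z i).re) • (fun i => (z i).re) -
          B w (fun i => (z i).im) • (fun i => (z i).im) :=
    ((h1.smul continuous_const).sub (h2.smul hre)).sub (h3.smul him)
  have hclosed : IsClosed {z : K3Index → ℂ |
      B (fun i => (z i).re) (fun i => (z i).re) • w -
        B w (fun i => (z i).re) • (fun i => (z i).re) -
          B w (fun i => (z i).im) • (fun i => (z i).im) = 0} :=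
    isClosed_eq hG continuous_const
  -- the defect vanishes frequently along `y`
  have hG0 : ∃ᶠ k in l, y k ∈ {z : K3Index → ℂ |
      B (fun i => (z i).re) (fun i => (z i).re) • w -
        B w (fun i => (z i).re) • (fun i => (z i).re) -
          B w (fun i => (z i).im) • (fun i => (z i).im) = 0} := by
    refine hw.mono fun k hk => ?_
    obtain ⟨a, b, hab⟩ := hk
    obtain ⟨hk12, hk11, -⟩ := (mem_k3PeriodDomain_iff_k3RForm hB (y k)).1 (hyD k)
    have hwv : w = a • (fun i => (y k i).re) + b • (fun i => (y k i).im) := by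
      funext i
      simp [hab i]
    have e1 : B w (fun i => (y k i).re) = a * B (fun i => (y k i).re) (fun i => (y k i).re) := by
      rw [hwv]
      simp only [LinearMap.BilinForm.add_left, LinearMap.BilinForm.smul_left]
      rw [hBs (fun i => (y k i).im) (fun i => (y k i).re), hk12]
      ring
    have e2 : B w (fun i => (y k i).im) = b * B (fun i => (y k i).re) (fun i => (y k i).re) := by
      rw [hwv]
      simp only [LinearMap.BilinForm.add_left, LinearMap.BilinForm.smul_left]
      rw [hk12, ← hk11]
      ring
    show B (fun i => (y k i).re) (fun i => (y k i).re) • w -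
        B w (fun i => (y k i).re) • (fun i => (y k i).re) -
          B w (fun i => (y k i).im) • (fun i => (y k i).im) = 0
    rw [e1, e2]
    conv_lhs => rw [hwv]
    module
  -- hence it vanishes at `y₀`
  have hG₀ : B (fun i => (y₀ i).re) (fun i => (y₀ i).re) • w -
      B w (fun i => (y₀ i).re) • (fun i => (y₀ i).re) -
        B w (fun i => (y₀ i).im) • (fun i => (y₀ i).im) = 0 :=
    hclosed.mem_of_frequently_of_tendsto hG0 hy
  obtain ⟨-, -, hpos⟩ := (mem_k3PeriodDomain_iff_k3RForm hB y₀).1 hy₀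
  refine ⟨B w (fun i => (y₀ i).re) / B (fun i => (y₀ i).re) (fun i => (y₀ i).re),
    B w (fun i => (y₀ i).im) / B (fun i => (y₀ i).re) (fun i => (y₀ i).re), fun i => ?_⟩
  have hi := congrFun hG₀ i
  simp only [Pi.sub_apply, Pi.smul_apply, smul_eq_mul, Pi.zero_apply] at hi
  rw [div_mul_eq_mul_div, div_mul_eq_mul_div, ← add_div, eq_div_iff hpos.ne']
  linear_combination hi

/-! ### The two elementary conjuncts of the trichotomy, and the reduction of the fact to density -/

/-- **Verbitsky's trichotomy, part (iii), second inclusion (elementary)**: if the positive plane of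
the period vector `x` contains a non-zero lattice vector `v`, then the plane of every period vector
`y` in the closure of the cone `{t • g x | g ∈ SO(Λ_{K3}), t ≠ 0}` (i.e. `[y] ∈ cl(Γ[x])` in
`Per ≅ Gr₊₊`) contains a non-zero lattice vector — in fact a vector of the `Γ`-orbit of `v`
(Verbitsky: `cl(Γ l) ⊆ {V₁ | V₁ ⊃ a rational line}`; here from the discreteness of `Λ` alone).
[cite: Verbitsky2017ErgodicErratum, §2.3 Theorem (iii)] -/
theorem exists_latticeVector_of_mem_closure_orbit {x : K3Index → ℂ} (hx : x ∈ k3PeriodDomain)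
    {v : K3Index → ℤ} (hv0 : v ≠ 0) {α β : ℝ}
    (hv : ∀ i, (v i : ℝ) = α * (x i).re + β * (x i).im)
    {y : K3Index → ℂ} (hy : y ∈ k3PeriodDomain)
    (hcl : y ∈ closure {z : K3Index → ℂ | ∃ (g : Matrix K3Index K3Index ℤ) (t : ℂ),
      g.transpose * k3Gram * g = k3Gram ∧ g.det = 1 ∧ t ≠ 0 ∧
        z = t • (g.map (Int.cast : ℤ → ℂ) *ᵥ x)}) :
    ∃ w : K3Index → ℤ, w ≠ 0 ∧ ∃ a b : ℝ, ∀ i, (w i : ℝ) = a * (y i).re + b * (y i).im := by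
  set B := Matrix.toBilin' (k3Gram.map (Int.cast : ℤ → ℝ)) with hB
  obtain ⟨yk, hmem, hlim⟩ := mem_closure_iff_seq_limit.1 hcl
  have hmem' : ∀ n, ∃ (g : Matrix K3Index K3Index ℤ) (t : ℂ),
      g.transpose * k3Gram * g = k3Gram ∧ g.det = 1 ∧ t ≠ 0 ∧
        yk n = t • (g.map (Int.cast : ℤ → ℂ) *ᵥ x) := fun n => hmem n
  choose g t hg _hdet ht hyk using hmem'
  have hD : ∀ k, yk k ∈ k3PeriodDomain := fun k => by
    rw [hyk k]; exact smul_map_mulVec_mem_k3PeriodDomain hx (hg k) (ht k)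
  have hplane : ∀ k, ∃ a b : ℝ, ∀ i,
      ((g k *ᵥ v) i : ℝ) = a * (yk k i).re + b * (yk k i).im := fun k => by
    rw [hyk k]; exact exists_inPlane_mulVec hv (g k) (ht k)
  have hQ : ∀ k, B (fun i => ((g k *ᵥ v) i : ℝ)) (fun i => ((g k *ᵥ v) i : ℝ)) =
      B (fun i => (v i : ℝ)) (fun i => (v i : ℝ)) := fun k => by
    have hc : (fun i => ((g k *ᵥ v) i : ℝ)) = (g k).map (Int.cast : ℤ → ℝ) *ᵥ fun i => (v i : ℝ) :=
      funext fun i => intCast_mulVec_apply (g k) v i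
    rw [hc, k3RForm_mulVec_mulVec hB (hg k)]
  -- boundedness and pigeonhole
  obtain ⟨m, hm⟩ := eventually_latticeVector_mem_Icc hB hlim hy hD
    (B (fun i => (v i : ℝ)) (fun i => (v i : ℝ)))
  have hev : ∀ᶠ k in atTop, g k *ᵥ v ∈ Set.pi Set.univ (fun _ : K3Index => Set.Icc (-m) m) := by
    filter_upwards [hm] with k hk
    obtain ⟨a, b, hab⟩ := hplane k
    exact fun i _ => hk _ a b hab (hQ k).le i
  obtain ⟨w, -, hw⟩ := exists_frequently_eq_of_eventually_mem
    (Set.Finite.pi fun _ => Set.finite_Icc (-m) m) hev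
  -- `w ≠ 0` because `(w.w) = (v.v) > 0`
  have hQv : 0 < B (fun i => (v i : ℝ)) (fun i => (v i : ℝ)) := k3RForm_pos_of_inPlane hB hx hv0 hv
  obtain ⟨k₀, hk₀⟩ := hw.exists
  have hw0 : w ≠ 0 := by
    rintro rfl
    have h0 := hQ k₀
    rw [hk₀] at h0
    simp only [Pi.zero_apply, Int.cast_zero] at h0
    have : B (fun _ : K3Index => (0 : ℝ)) (fun _ => (0 : ℝ)) = 0 := by
      rw [show (fun _ : K3Index => (0 : ℝ)) = 0 from rfl, LinearMap.BilinForm.zero_left]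
    rw [this] at h0
    exact hQv.ne h0
  refine ⟨w, hw0, exists_inPlane_of_frequently hlim hy hD (fun i => (w i : ℝ)) ?_⟩
  refine hw.mono fun k hk => ?_
  rw [← hk]
  exact hplane k

/-- **Verbitsky's trichotomy, part (i) (elementary)**: if the positive plane `P_x = ⟨Re x, Im x⟩` of
the period vector `x` is rational (spanned over `ℝ` by two lattice vectors), then the cone
`{t • g x | g ∈ SO(Λ_{K3}), t ≠ 0}` representing `Γ[x] ⊂ Per` is closed in the period domain:
every period vector in its closure belongs to it (Verbitsky: "`Γ l` is closed. This happens when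
the 2-plane `l ⊂ V` is rational"; here from the discreteness of `Λ` alone).
[cite: Verbitsky2017ErgodicErratum, §2.3 Theorem (i)] -/
theorem mem_orbit_of_rationalPlane_of_mem_closure {x : K3Index → ℂ} (hx : x ∈ k3PeriodDomain)
    {u w : K3Index → ℤ} {a b c d : ℝ}
    (hrat : ∀ i, (x i).re = a * u i + b * w i ∧ (x i).im = c * u i + d * w i)
    {y : K3Index → ℂ} (hy : y ∈ k3PeriodDomain)
    (hcl : y ∈ closure {z : K3Index → ℂ | ∃ (g : Matrix K3Index K3Index ℤ) (t : ℂ),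
      g.transpose * k3Gram * g = k3Gram ∧ g.det = 1 ∧ t ≠ 0 ∧
        z = t • (g.map (Int.cast : ℤ → ℂ) *ᵥ x)}) :
    ∃ (g : Matrix K3Index K3Index ℤ) (t : ℂ), g.transpose * k3Gram * g = k3Gram ∧ g.det = 1 ∧
      t ≠ 0 ∧ y = t • (g.map (Int.cast : ℤ → ℂ) *ᵥ x) := by
  set B := Matrix.toBilin' (k3Gram.map (Int.cast : ℤ → ℝ)) with hB
  obtain ⟨yk, hmem, hlim⟩ := mem_closure_iff_seq_limit.1 hcl
  have hmem' : ∀ n, ∃ (g : Matrix K3Index K3Index ℤ) (t : ℂ),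
      g.transpose * k3Gram * g = k3Gram ∧ g.det = 1 ∧ t ≠ 0 ∧
        yk n = t • (g.map (Int.cast : ℤ → ℂ) *ᵥ x) := fun n => hmem n
  choose g t hg hdet ht hyk using hmem'
  obtain ⟨⟨αu, βu, hu⟩, ⟨αw, βw, hw⟩⟩ := exists_inPlane_of_rationalPlane hx hrat
  have hD : ∀ k, yk k ∈ k3PeriodDomain := fun k => by
    rw [hyk k]; exact smul_map_mulVec_mem_k3PeriodDomain hx (hg k) (ht k)
  have hpu : ∀ k, ∃ a b : ℝ, ∀ i,
      ((g k *ᵥ u) i : ℝ) = a * (yk k i).re + b * (yk k i).im := fun k => by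
    rw [hyk k]; exact exists_inPlane_mulVec hu (g k) (ht k)
  have hpw : ∀ k, ∃ a b : ℝ, ∀ i,
      ((g k *ᵥ w) i : ℝ) = a * (yk k i).re + b * (yk k i).im := fun k => by
    rw [hyk k]; exact exists_inPlane_mulVec hw (g k) (ht k)
  have hQ : ∀ (p : K3Index → ℤ) k, B (fun i => ((g k *ᵥ p) i : ℝ)) (fun i => ((g k *ᵥ p) i : ℝ)) =
      B (fun i => (p i : ℝ)) (fun i => (p i : ℝ)) := fun p k => by
    have hc : (fun i => ((g k *ᵥ p) i : ℝ)) = (g k).map (Int.cast : ℤ → ℝ) *ᵥ fun i => (p i : ℝ) :=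
      funext fun i => intCast_mulVec_apply (g k) p i
    rw [hc, k3RForm_mulVec_mulVec hB (hg k)]
  -- boundedness and pigeonhole for the pair `(g_k u, g_k w)`
  obtain ⟨m, hm⟩ := eventually_latticeVector_mem_Icc hB hlim hy hD
    (max (B (fun i => (u i : ℝ)) (fun i => (u i : ℝ))) (B (fun i => (w i : ℝ)) (fun i => (w i : ℝ))))
  have hev : ∀ᶠ k in atTop, (g k *ᵥ u, g k *ᵥ w) ∈
      (Set.pi Set.univ (fun _ : K3Index => Set.Icc (-m) m)) ×ˢ
        (Set.pi Set.univ (fun _ : K3Index => Set.Icc (-m) m)) := by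
    filter_upwards [hm] with k hk
    obtain ⟨a₁, b₁, h₁⟩ := hpu k
    obtain ⟨a₂, b₂, h₂⟩ := hpw k
    exact ⟨fun i _ => hk _ a₁ b₁ h₁ ((hQ u k).le.trans (le_max_left _ _)) i,
      fun i _ => hk _ a₂ b₂ h₂ ((hQ w k).le.trans (le_max_right _ _)) i⟩
  obtain ⟨q, -, hfr⟩ := exists_frequently_eq_of_eventually_mem
    ((Set.Finite.pi fun _ => Set.finite_Icc (-m) m).prod
      (Set.Finite.pi fun _ => Set.finite_Icc (-m) m)) hev
  obtain ⟨K, hK⟩ := hfr.exists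
  -- along the frequent set, `g_k x` is the fixed vector `ξ = g_K x`
  have hgx : ∀ k, (g k *ᵥ u, g k *ᵥ w) = q →
      (g k).map (Int.cast : ℤ → ℂ) *ᵥ x = (g K).map (Int.cast : ℤ → ℂ) *ᵥ x := by
    intro k hk
    have hkK := hk.trans hK.symm
    simp only [Prod.mk.injEq] at hkK
    obtain ⟨e1, e2⟩ := hkK
    rw [map_mulVec_eq_of_rationalPlane hrat (g k), map_mulVec_eq_of_rationalPlane hrat (g K),
      e1, e2]
  have hfrS : ∃ᶠ k in atTop,
      yk k ∈ (Submodule.span ℂ {(g K).map (Int.cast : ℤ → ℂ) *ᵥ x} : Set (K3Index → ℂ)) := by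
    refine hfr.mono fun k hk => ?_
    rw [hyk k, hgx k hk]
    exact Submodule.smul_mem _ _ (Submodule.subset_span rfl)
  have hyS : y ∈ (Submodule.span ℂ {(g K).map (Int.cast : ℤ → ℂ) *ᵥ x} : Set (K3Index → ℂ)) :=
    (Submodule.closed_of_finiteDimensional _).mem_of_frequently_of_tendsto hfrS hlim
  obtain ⟨s, hs⟩ := Submodule.mem_span_singleton.1 hyS
  have hs0 : s ≠ 0 := by
    rintro rfl
    rw [zero_smul] at hs
    have h0 := hy.2
    rw [← hs] at h0
    simp [k3Form] at h0
  exact ⟨g K, s, hg K, hdet K, hs0, hs.symm⟩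

/-- **Reduction of the named fact to its density conjuncts.** Verbitsky's orbit-closure trichotomy
for `Λ_{K3}` (`Verbitsky2017_orbitClosure_trichotomy_K3`) follows from its two Ratner-theoretic
conjuncts alone — (ii): a period vector whose plane contains no rational vector has a dense cone,
and (iii), first inclusion: if the plane of `x` contains the non-zero lattice vector `v` and is not
rational, every period vector whose plane contains `v` lies in the closure of the cone of `x` —
the other two conjuncts ((i) and (iii), second inclusion) being the unconditional theorems
`mem_orbit_of_rationalPlane_of_mem_closure` and `exists_latticeVector_of_mem_closure_orbit`.
[cite: Verbitsky2017ErgodicErratum, §2.3 Theorem (i)–(iii)] -/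
theorem Verbitsky2017_orbitClosure_trichotomy_K3_of_dense
    (hdense : ∀ x : K3Index → ℂ, x ∈ k3PeriodDomain →
      (∀ v : K3Index → ℤ, (∃ a b : ℝ, ∀ i, (v i : ℝ) = a * (x i).re + b * (x i).im) → v = 0) →
      ∀ y : K3Index → ℂ, y ∈ k3PeriodDomain →
        y ∈ closure {z : K3Index → ℂ | ∃ (g : Matrix K3Index K3Index ℤ) (t : ℂ),
          g.transpose * k3Gram * g = k3Gram ∧ g.det = 1 ∧ t ≠ 0 ∧
            z = t • (g.map (Int.cast : ℤ → ℂ) *ᵥ x)})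
    (hinter : ∀ x : K3Index → ℂ, x ∈ k3PeriodDomain → ∀ v : K3Index → ℤ, v ≠ 0 →
      (∃ a b : ℝ, ∀ i, (v i : ℝ) = a * (x i).re + b * (x i).im) →
      (¬ ∃ (u w : K3Index → ℤ) (a b c d : ℝ), ∀ i,
          (x i).re = a * u i + b * w i ∧ (x i).im = c * u i + d * w i) →
      ∀ y : K3Index → ℂ, y ∈ k3PeriodDomain →
        (∃ a b : ℝ, ∀ i, (v i : ℝ) = a * (y i).re + b * (y i).im) →
        y ∈ closure {z : K3Index → ℂ | ∃ (g : Matrix K3Index K3Index ℤ) (t : ℂ),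
          g.transpose * k3Gram * g = k3Gram ∧ g.det = 1 ∧ t ≠ 0 ∧
            z = t • (g.map (Int.cast : ℤ → ℂ) *ᵥ x)}) :
    Verbitsky2017_orbitClosure_trichotomy_K3 := by
  intro x hx
  refine ⟨?_, hdense x hx, fun v hv0 hvx hnrat => ⟨hinter x hx v hv0 hvx hnrat, ?_⟩⟩
  · rintro ⟨u, w, a, b, c, d, h⟩ y hy hcl
    exact mem_orbit_of_rationalPlane_of_mem_closure hx h hy hcl
  · intro y hy hcl
    obtain ⟨a, b, hab⟩ := hvx
    exact exists_latticeVector_of_mem_closure_orbit hx hv0 hab hy hcl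

/-! ### The orbit forms of conjunct (iii): `cl(Γ l) ⊆ Γ · Gr₊₊(v)` and `Γ`-invariance of the closure -/

/-- **Verbitsky's trichotomy, part (iii), second inclusion in orbit form** `cl(Γ l) ⊆ Γ · Gr₊₊(v)`:
if the plane of the period vector `x` contains the lattice vector `v`, then for every period
vector `y` in the closure of the cone `{t • g x | g ∈ SO(Λ_{K3}), t ≠ 0}` some vector `g v` of the
`SO(Λ_{K3})`-orbit of `v` lies in the plane of `y`, i.e. the plane of `y` is a `Γ`-translate of a
positive plane through `v` (in print: the closure in case (iii) is the `Γ`-orbit of the set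
`Gr₊₊(v)` of positive planes through `v`, the intermediate group being `Stab(v) = SO⁺(a−1,b)`;
this sharpens `exists_latticeVector_of_mem_closure_orbit`, and uses the discreteness of `Λ`
only). [cite: Verbitsky2017ErgodicErratum, §2.3 Theorem (iii) and its proof] -/
theorem exists_orbit_latticeVector_of_mem_closure_orbit {x : K3Index → ℂ}
    (hx : x ∈ k3PeriodDomain) {v : K3Index → ℤ} {α β : ℝ}
    (hv : ∀ i, (v i : ℝ) = α * (x i).re + β * (x i).im)
    {y : K3Index → ℂ} (hy : y ∈ k3PeriodDomain)
    (hcl : y ∈ closure {z : K3Index → ℂ | ∃ (g : Matrix K3Index K3Index ℤ) (t : ℂ),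
      g.transpose * k3Gram * g = k3Gram ∧ g.det = 1 ∧ t ≠ 0 ∧
        z = t • (g.map (Int.cast : ℤ → ℂ) *ᵥ x)}) :
    ∃ g : Matrix K3Index K3Index ℤ, g.transpose * k3Gram * g = k3Gram ∧ g.det = 1 ∧
      ∃ a b : ℝ, ∀ i, ((g *ᵥ v) i : ℝ) = a * (y i).re + b * (y i).im := by
  set B := Matrix.toBilin' (k3Gram.map (Int.cast : ℤ → ℝ)) with hB
  obtain ⟨yk, hmem, hlim⟩ := mem_closure_iff_seq_limit.1 hcl
  have hmem' : ∀ n, ∃ (g : Matrix K3Index K3Index ℤ) (t : ℂ),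
      g.transpose * k3Gram * g = k3Gram ∧ g.det = 1 ∧ t ≠ 0 ∧
        yk n = t • (g.map (Int.cast : ℤ → ℂ) *ᵥ x) := fun n => hmem n
  choose g t hg hdet ht hyk using hmem'
  have hD : ∀ k, yk k ∈ k3PeriodDomain := fun k => by
    rw [hyk k]; exact smul_map_mulVec_mem_k3PeriodDomain hx (hg k) (ht k)
  have hplane : ∀ k, ∃ a b : ℝ, ∀ i,
      ((g k *ᵥ v) i : ℝ) = a * (yk k i).re + b * (yk k i).im := fun k => by
    rw [hyk k]; exact exists_inPlane_mulVec hv (g k) (ht k)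
  have hQ : ∀ k, B (fun i => ((g k *ᵥ v) i : ℝ)) (fun i => ((g k *ᵥ v) i : ℝ)) =
      B (fun i => (v i : ℝ)) (fun i => (v i : ℝ)) := fun k => by
    have hc : (fun i => ((g k *ᵥ v) i : ℝ)) = (g k).map (Int.cast : ℤ → ℝ) *ᵥ fun i => (v i : ℝ) :=
      funext fun i => intCast_mulVec_apply (g k) v i
    rw [hc, k3RForm_mulVec_mulVec hB (hg k)]
  obtain ⟨m, hm⟩ := eventually_latticeVector_mem_Icc hB hlim hy hD
    (B (fun i => (v i : ℝ)) (fun i => (v i : ℝ)))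
  have hev : ∀ᶠ k in atTop, g k *ᵥ v ∈ Set.pi Set.univ (fun _ : K3Index => Set.Icc (-m) m) := by
    filter_upwards [hm] with k hk
    obtain ⟨a, b, hab⟩ := hplane k
    exact fun i _ => hk _ a b hab (hQ k).le i
  obtain ⟨w, -, hw⟩ := exists_frequently_eq_of_eventually_mem
    (Set.Finite.pi fun _ => Set.finite_Icc (-m) m) hev
  obtain ⟨k₀, hk₀⟩ := hw.exists
  refine ⟨g k₀, hg k₀, hdet k₀, ?_⟩
  rw [hk₀]
  refine exists_inPlane_of_frequently hlim hy hD (fun i => (w i : ℝ)) ?_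
  refine hw.mono fun k hk => ?_
  rw [← hk]
  exact hplane k

/-- **The closure of the cone is `SO(Λ_{K3}) × ℂˣ`-invariant**: if `y` lies in the closure of the
cone `{t • g x}` of `x`, so does `t • g y` for every integral isometry `g` of determinant `1` and
every `t ≠ 0` (the map `z ↦ t • g z` is continuous and maps the cone into itself). Hence the
first inclusion of conjunct (iii) as rendered in the fact (`Gr₊₊(v) ⊆` closure) is equivalent to
its printed form `Γ · Gr₊₊(v) ⊆ cl(Γ l)`. [cite: Verbitsky2017ErgodicErratum, §2.3 Theorem (iii)] -/
theorem smul_map_mulVec_mem_closure_orbit {x y : K3Index → ℂ}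
    (hcl : y ∈ closure {z : K3Index → ℂ | ∃ (g : Matrix K3Index K3Index ℤ) (t : ℂ),
      g.transpose * k3Gram * g = k3Gram ∧ g.det = 1 ∧ t ≠ 0 ∧
        z = t • (g.map (Int.cast : ℤ → ℂ) *ᵥ x)})
    {g : Matrix K3Index K3Index ℤ} (hg : g.transpose * k3Gram * g = k3Gram) (hdet : g.det = 1)
    {t : ℂ} (ht : t ≠ 0) :
    t • (g.map (Int.cast : ℤ → ℂ) *ᵥ y) ∈ closure {z : K3Index → ℂ |
      ∃ (g : Matrix K3Index K3Index ℤ) (t : ℂ), g.transpose * k3Gram * g = k3Gram ∧ g.det = 1 ∧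
        t ≠ 0 ∧ z = t • (g.map (Int.cast : ℤ → ℂ) *ᵥ x)} := by
  have hcont : Continuous fun z : K3Index → ℂ => t • (g.map (Int.cast : ℤ → ℂ) *ᵥ z) :=
    (continuous_const.matrix_mulVec continuous_id).const_smul t
  refine map_mem_closure (f := fun z : K3Index → ℂ => t • (g.map (Int.cast : ℤ → ℂ) *ᵥ z))
    hcont hcl ?_
  rintro z ⟨g', t', hg', hdet', ht', rfl⟩
  refine ⟨g * g', t * t', ?_, ?_, mul_ne_zero ht ht', ?_⟩
  · calc (g * g').transpose * k3Gram * (g * g')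
          = g'.transpose * (g.transpose * k3Gram * g) * g' := by
            rw [Matrix.transpose_mul]; simp only [Matrix.mul_assoc]
      _ = k3Gram := by rw [hg, hg']
  · rw [Matrix.det_mul, hdet, hdet', mul_one]
  · have hmap : (g * g').map (Int.cast : ℤ → ℂ) =
        g.map (Int.cast : ℤ → ℂ) * g'.map (Int.cast : ℤ → ℂ) := by
      have h := (Matrix.map_mul (L := g) (M := g') (f := Int.castRingHom ℂ))
      simpa using h
    show t • (g.map (Int.cast : ℤ → ℂ) *ᵥ (t' • (g'.map (Int.cast : ℤ → ℂ) *ᵥ x))) =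
      (t * t') • ((g * g').map (Int.cast : ℤ → ℂ) *ᵥ x)
    rw [Matrix.mulVec_smul, smul_smul, Matrix.mulVec_mulVec, hmap]

/-! ### Period vectors with a common plane (`D → Gr₊₊(Λ_ℝ)` is a `ℂˣ`-bundle) -/

/-- **Period vectors with the same positive plane differ by a scalar, or by a scalar and complex
conjugation** (Huybrechts Ch. 6 Prop. 1.5: `x ↦ P_x = ⟨Re x, Im x⟩` identifies `D/ℂˣ` with the
Grassmannian of ORIENTED positive planes, complex conjugation reversing the orientation; Verbitsky
§2.3 Claim `Gr₊₊ ≅ Per`): if `x, x' ∈ D` and `Re x' = a Re x + b Im x`, `Im x' = c Re x + d Im x`,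
then either `ad − bc > 0` and `x' = (a − ib) • x`, or `ad − bc < 0` and `x' = (a + ib) • x̄`.
[cite: Huybrechts2016K3, Ch. 6 Prop. 1.5] -/
theorem eq_smul_or_eq_smul_star_of_re_im {x x' : K3Index → ℂ} (hx : x ∈ k3PeriodDomain)
    (hx' : x' ∈ k3PeriodDomain) {a b c d : ℝ}
    (hre : ∀ i, (x' i).re = a * (x i).re + b * (x i).im)
    (him : ∀ i, (x' i).im = c * (x i).re + d * (x i).im) :
    (0 < a * d - b * c ∧ x' = (⟨a, -b⟩ : ℂ) • x) ∨
      (a * d - b * c < 0 ∧ x' = (⟨a, b⟩ : ℂ) • star x) := by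
  set B := Matrix.toBilin' (k3Gram.map (Int.cast : ℤ → ℝ)) with hB
  obtain ⟨h12, h11, hpos⟩ := (mem_k3PeriodDomain_iff_k3RForm hB x).1 hx
  have h21 : B (fun i => (x i).im) (fun i => (x i).re) = 0 := by
    rw [hB, k3RForm_comm, ← hB]; exact h12
  obtain ⟨h12', h11', hpos'⟩ := (mem_k3PeriodDomain_iff_k3RForm hB x').1 hx'
  have exr : (fun i => (x' i).re) = a • (fun i => (x i).re) + b • (fun i => (x i).im) := by
    funext i
    simp [hre i]
  have exi : (fun i => (x' i).im) = c • (fun i => (x i).re) + d • (fun i => (x i).im) := by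
    funext i
    simp [him i]
  -- `a² + b² > 0` (else `Re x' = 0`)
  have hr : 0 < a * a + b * b := by
    by_contra hle
    have ha : a = 0 := by nlinarith [mul_self_nonneg a, mul_self_nonneg b]
    have hb : b = 0 := by nlinarith [mul_self_nonneg a, mul_self_nonneg b]
    have exr0 : (fun i => (x' i).re) = 0 := by
      rw [exr, ha, hb, zero_smul, zero_smul, add_zero]
    rw [exr0] at hpos'
    simp at hpos'
  -- the scalar identities `ac + bd = 0`, `a² + b² = c² + d²`
  rw [exr, exi] at h12' h11'
  simp only [LinearMap.BilinForm.add_left, LinearMap.BilinForm.add_right,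
    LinearMap.BilinForm.smul_left, LinearMap.BilinForm.smul_right] at h12' h11'
  have hac' : (a * c + b * d) * B (fun i => (x i).re) (fun i => (x i).re) = 0 := by
    linear_combination h12' - (a * d) * h12 - (b * c) * h21 + (b * d) * h11
  have hac : a * c + b * d = 0 := by
    rcases mul_eq_zero.1 hac' with h | h
    · exact h
    · exact absurd h hpos.ne'
  have hnorm' : (a * a + b * b) * B (fun i => (x i).re) (fun i => (x i).re) =
      (c * c + d * d) * B (fun i => (x i).re) (fun i => (x i).re) := by
    linear_combination h11' - (a * b - c * d) * h12 - (a * b - c * d) * h21 + (b * b - d * d) * h11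
  have hnorm : a * a + b * b = c * c + d * d := mul_right_cancel₀ hpos.ne' hnorm'
  -- `(ad − bc)² = (a² + b²)²` (Lagrange's identity)
  have hΔ2 : (a * d - b * c) * (a * d - b * c) = (a * a + b * b) * (a * a + b * b) := by
    linear_combination (-(a * a + b * b)) * hnorm - (a * c + b * d) * hac
  rcases mul_self_eq_mul_self_iff.1 hΔ2 with hΔ | hΔ
  · -- positively oriented: `c = −b`, `d = a`
    have hsq : (c + b) * (c + b) + (d - a) * (d - a) = 0 := by
      linear_combination (-1 : ℝ) * hnorm - 2 * hΔ
    obtain ⟨hcb, hda⟩ := mul_self_add_mul_self_eq_zero.1 hsq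
    have hc : c = -b := eq_neg_of_add_eq_zero_left hcb
    have hd : d = a := sub_eq_zero.1 hda
    refine Or.inl ⟨by rw [hΔ]; exact hr, ?_⟩
    funext i
    apply Complex.ext
    · simp only [Pi.smul_apply, smul_eq_mul, Complex.mul_re, hre i]
      ring
    · simp only [Pi.smul_apply, smul_eq_mul, Complex.mul_im, him i, hc, hd]
      ring
  · -- negatively oriented: `c = b`, `d = −a`
    have hsq : (c - b) * (c - b) + (d + a) * (d + a) = 0 := by
      linear_combination (-1 : ℝ) * hnorm + 2 * hΔ
    obtain ⟨hcb, hda⟩ := mul_self_add_mul_self_eq_zero.1 hsq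
    have hc : c = b := sub_eq_zero.1 hcb
    have hd : d = -a := eq_neg_of_add_eq_zero_left hda
    refine Or.inr ⟨by rw [hΔ]; linarith, ?_⟩
    funext i
    apply Complex.ext
    · simp only [Pi.smul_apply, Pi.star_apply, smul_eq_mul, Complex.star_def, Complex.mul_re,
        Complex.conj_re, Complex.conj_im, hre i]
      ring
    · simp only [Pi.smul_apply, Pi.star_apply, smul_eq_mul, Complex.star_def, Complex.mul_im,
        Complex.conj_re, Complex.conj_im, him i, hc, hd]
      ring

/-! ### The intermediate case: `l ∩ V_ℚ` is a line -/

/-- **In the intermediate case the rational vectors of the plane form one line** (Verbitsky §1.1: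
the third class of orbits is `dim_ℚ (l ∩ V_ℚ) = 1`): if the plane of the period vector `x` is NOT
rational and contains the non-zero lattice vector `v`, then every lattice vector `w` of the plane
is commensurable with `v`: `n w = m v` with `n ≠ 0` (two independent lattice vectors would span
the plane). [cite: Verbitsky2017ErgodicErratum, §1.1 and §2.3 Theorem (iii)] -/
theorem exists_smul_eq_smul_of_not_rationalPlane {x : K3Index → ℂ}
    {v w : K3Index → ℤ} (hv0 : v ≠ 0) {α β γ δ : ℝ}
    (hv : ∀ i, (v i : ℝ) = α * (x i).re + β * (x i).im)
    (hw : ∀ i, (w i : ℝ) = γ * (x i).re + δ * (x i).im)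
    (hnrat : ¬ ∃ (u w : K3Index → ℤ) (a b c d : ℝ), ∀ i,
      (x i).re = a * u i + b * w i ∧ (x i).im = c * u i + d * w i) :
    ∃ m n : ℤ, n ≠ 0 ∧ n • w = m • v := by
  -- the coefficient matrix of `(v, w)` in `(Re x, Im x)` is singular
  have hΔ : α * δ - β * γ = 0 := by
    by_contra hΔ
    apply hnrat
    refine ⟨v, w, δ / (α * δ - β * γ), -β / (α * δ - β * γ), -γ / (α * δ - β * γ),
      α / (α * δ - β * γ), fun i => ⟨?_, ?_⟩⟩
    · rw [hv i, hw i, div_mul_eq_mul_div, div_mul_eq_mul_div, ← add_div, eq_div_iff hΔ]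
      ring
    · rw [hv i, hw i, div_mul_eq_mul_div, div_mul_eq_mul_div, ← add_div, eq_div_iff hΔ]
      ring
  -- hence `w` is a real multiple of `v`
  have hl : ∃ l : ℝ, ∀ i, (w i : ℝ) = l * v i := by
    by_cases hβ : β = 0
    · have hα : α ≠ 0 := by
        rintro rfl
        apply hv0
        funext i
        have hi := hv i
        rw [hβ, zero_mul, zero_mul, add_zero] at hi
        exact_mod_cast hi
      have hδ : δ = 0 := by
        rw [hβ, zero_mul, sub_zero] at hΔ
        rcases mul_eq_zero.1 hΔ with h | h
        · exact absurd h hα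
        · exact h
      refine ⟨γ / α, fun i => ?_⟩
      rw [hw i, hv i, hβ, hδ, div_mul_eq_mul_div, eq_div_iff hα]
      ring
    · refine ⟨δ / β, fun i => ?_⟩
      rw [hw i, hv i, div_mul_eq_mul_div, eq_div_iff hβ]
      linear_combination (-(x i).re) * hΔ
  obtain ⟨l, hl⟩ := hl
  obtain ⟨i₀, hi₀⟩ := Function.ne_iff.1 hv0
  refine ⟨w i₀, v i₀, hi₀, ?_⟩
  funext j
  simp only [Pi.smul_apply, smul_eq_mul]
  have h : (v i₀ : ℝ) * w j = w i₀ * v j := by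
    rw [hl j, hl i₀]
    ring
  exact_mod_cast h

/-! ### Reduction of conjunct (iii), first inclusion, to orbit density of the stabiliser of `v` -/

/-- **Conjunct (iii), first inclusion (`Gr₊₊(v) ⊆ cl(Γ l)`), from orbit density of `Γ_v` on the
spheres of `v^⊥`** — the intermediate subgroup `Stab(v) = SO⁺(a−1,b)` of the printed proof: assume
that for the non-zero lattice vector `v` the stabiliser `Γ_v = {g ∈ SO(Λ_{K3}) | g v = v}` has a
dense orbit through every vector `w₀ ∈ v^⊥ ⊂ Λ_ℝ` of positive square whose line `ℝ w₀` contains no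
lattice point but `0`, inside the sphere `{w ∈ v^⊥ | (w.w) = (w₀.w₀)}` (the Ratner-theoretic input,
NOT proved here). Then, if `v` lies in the NON-rational plane of the period vector `x`, every
period vector `y` whose plane contains `v` lies in the closure of the cone of `x`. Glue: `P_x` has
the orthogonal basis `(v, w₀)`, `w₀ = −β Re x + α Im x`, with `v + i w₀ = (α − iβ) x`; `ℝ w₀` is
lattice-free because `P_x` is not rational; if `g_k ∈ Γ_v` and `g_k w₀ → w`, `(v, w)` the
corresponding basis of `P_y` (`v + i w = (α' − iβ') y`), then `((α − iβ)/(α' − iβ')) g_k x → y`.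
[cite: Verbitsky2017ErgodicErratum, §2.3 Theorem (iii) and its proof, §2.1] -/
theorem mem_closure_orbit_of_stabilizer_orbit_dense {x : K3Index → ℂ} (hx : x ∈ k3PeriodDomain)
    {v : K3Index → ℤ} (hv0 : v ≠ 0) {α β : ℝ}
    (hv : ∀ i, (v i : ℝ) = α * (x i).re + β * (x i).im)
    (hnrat : ¬ ∃ (u w : K3Index → ℤ) (a b c d : ℝ), ∀ i,
      (x i).re = a * u i + b * w i ∧ (x i).im = c * u i + d * w i)
    (hdense : ∀ w₀ w : K3Index → ℝ,
      Matrix.toBilin' (k3Gram.map (Int.cast : ℤ → ℝ)) (fun i => (v i : ℝ)) w₀ = 0 →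
      Matrix.toBilin' (k3Gram.map (Int.cast : ℤ → ℝ)) (fun i => (v i : ℝ)) w = 0 →
      0 < Matrix.toBilin' (k3Gram.map (Int.cast : ℤ → ℝ)) w₀ w₀ →
      Matrix.toBilin' (k3Gram.map (Int.cast : ℤ → ℝ)) w w =
        Matrix.toBilin' (k3Gram.map (Int.cast : ℤ → ℝ)) w₀ w₀ →
      (∀ (p : K3Index → ℤ) (c : ℝ), (∀ i, (p i : ℝ) = c * w₀ i) → p = 0) →
      w ∈ closure {z : K3Index → ℝ | ∃ g : Matrix K3Index K3Index ℤ,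
        g.transpose * k3Gram * g = k3Gram ∧ g.det = 1 ∧ g *ᵥ v = v ∧
          z = g.map (Int.cast : ℤ → ℝ) *ᵥ w₀})
    {y : K3Index → ℂ} (hy : y ∈ k3PeriodDomain) {α' β' : ℝ}
    (hvy : ∀ i, (v i : ℝ) = α' * (y i).re + β' * (y i).im) :
    y ∈ closure {z : K3Index → ℂ | ∃ (g : Matrix K3Index K3Index ℤ) (t : ℂ),
      g.transpose * k3Gram * g = k3Gram ∧ g.det = 1 ∧ t ≠ 0 ∧
        z = t • (g.map (Int.cast : ℤ → ℂ) *ᵥ x)} := by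
  set B := Matrix.toBilin' (k3Gram.map (Int.cast : ℤ → ℝ)) with hB
  have hBs : ∀ u w, B u w = B w u := fun u w => by rw [hB]; exact k3RForm_comm u w
  obtain ⟨h12, h11, hpos⟩ := (mem_k3PeriodDomain_iff_k3RForm hB x).1 hx
  obtain ⟨h12y, h11y, hposy⟩ := (mem_k3PeriodDomain_iff_k3RForm hB y).1 hy
  -- the second basis vectors `w₀ ⊥ v` of `P_x` and `w ⊥ v` of `P_y`
  set w₀ : K3Index → ℝ := fun i => -β * (x i).re + α * (x i).im with hw₀
  set w : K3Index → ℝ := fun i => -β' * (y i).re + α' * (y i).im with hw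
  have hvR : (fun i => (v i : ℝ)) = α • (fun i => (x i).re) + β • (fun i => (x i).im) := by
    funext i
    simp [hv i]
  have hvRy : (fun i => (v i : ℝ)) = α' • (fun i => (y i).re) + β' • (fun i => (y i).im) := by
    funext i
    simp [hvy i]
  have hw₀v : w₀ = (-β) • (fun i => (x i).re) + α • (fun i => (x i).im) := by
    funext i
    simp [hw₀]
  have hwv : w = (-β') • (fun i => (y i).re) + α' • (fun i => (y i).im) := by
    funext i
    simp [hw]
  -- `(α, β) ≠ 0`, `(α', β') ≠ 0`
  have hr : 0 < α * α + β * β := by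
    by_contra hle
    have ha : α = 0 := by nlinarith [mul_self_nonneg α, mul_self_nonneg β]
    have hb : β = 0 := by nlinarith [mul_self_nonneg α, mul_self_nonneg β]
    apply hv0
    funext i
    have hi := hv i
    rw [ha, hb, zero_mul, zero_mul, add_zero] at hi
    exact_mod_cast hi
  have hr' : 0 < α' * α' + β' * β' := by
    by_contra hle
    have ha : α' = 0 := by nlinarith [mul_self_nonneg α', mul_self_nonneg β']
    have hb : β' = 0 := by nlinarith [mul_self_nonneg α', mul_self_nonneg β']
    apply hv0
    funext i
    have hi := hvy i
    rw [ha, hb, zero_mul, zero_mul, add_zero] at hi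
    exact_mod_cast hi
  have h21 : B (fun i => (x i).im) (fun i => (x i).re) = 0 := by
    rw [hBs]; exact h12
  have h21y : B (fun i => (y i).im) (fun i => (y i).re) = 0 := by
    rw [hBs]; exact h12y
  -- the hypotheses of the density input: `w₀ ⊥ v`, `w ⊥ v`, `(w₀)² = (w)² = (v)² > 0`
  have h1 : B (fun i => (v i : ℝ)) w₀ = 0 := by
    rw [hvR, hw₀v]
    simp only [LinearMap.BilinForm.add_left, LinearMap.BilinForm.add_right,
      LinearMap.BilinForm.smul_left, LinearMap.BilinForm.smul_right]
    linear_combination (α * α) * h12 - (β * β) * h21 - (α * β) * h11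
  have h2 : B (fun i => (v i : ℝ)) w = 0 := by
    rw [hvRy, hwv]
    simp only [LinearMap.BilinForm.add_left, LinearMap.BilinForm.add_right,
      LinearMap.BilinForm.smul_left, LinearMap.BilinForm.smul_right]
    linear_combination (α' * α') * h12y - (β' * β') * h21y - (α' * β') * h11y
  have hw₀w₀ : B w₀ w₀ = (α * α + β * β) * B (fun i => (x i).re) (fun i => (x i).re) := by
    rw [hw₀v]
    simp only [LinearMap.BilinForm.add_left, LinearMap.BilinForm.add_right,
      LinearMap.BilinForm.smul_left, LinearMap.BilinForm.smul_right]
    linear_combination (-(α * β)) * h12 - (α * β) * h21 - (α * α) * h11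
  have hww : B w w = (α' * α' + β' * β') * B (fun i => (y i).re) (fun i => (y i).re) := by
    rw [hwv]
    simp only [LinearMap.BilinForm.add_left, LinearMap.BilinForm.add_right,
      LinearMap.BilinForm.smul_left, LinearMap.BilinForm.smul_right]
    linear_combination (-(α' * β')) * h12y - (α' * β') * h21y - (α' * α') * h11y
  have hvv : B (fun i => (v i : ℝ)) (fun i => (v i : ℝ)) =
      (α * α + β * β) * B (fun i => (x i).re) (fun i => (x i).re) := by
    rw [hvR]
    simp only [LinearMap.BilinForm.add_left, LinearMap.BilinForm.add_right,
      LinearMap.BilinForm.smul_left, LinearMap.BilinForm.smul_right]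
    linear_combination (α * β) * h12 + (α * β) * h21 - (β * β) * h11
  have hvvy : B (fun i => (v i : ℝ)) (fun i => (v i : ℝ)) =
      (α' * α' + β' * β') * B (fun i => (y i).re) (fun i => (y i).re) := by
    rw [hvRy]
    simp only [LinearMap.BilinForm.add_left, LinearMap.BilinForm.add_right,
      LinearMap.BilinForm.smul_left, LinearMap.BilinForm.smul_right]
    linear_combination (α' * β') * h12y + (α' * β') * h21y - (β' * β') * h11y
  have h3 : 0 < B w₀ w₀ := by
    rw [hw₀w₀]; exact mul_pos hr hpos
  have h4 : B w w = B w₀ w₀ := by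
    rw [hww, hw₀w₀, ← hvv, ← hvvy]
  -- `ℝ w₀` is lattice-free, because `P_x = ⟨v, w₀⟩` is not rational
  have hr2 : α * α + β * β ≠ 0 := hr.ne'
  have h5 : ∀ (p : K3Index → ℤ) (c : ℝ), (∀ i, (p i : ℝ) = c * w₀ i) → p = 0 := by
    intro p c hp
    by_contra hp0
    have hc : c ≠ 0 := by
      rintro rfl
      apply hp0
      funext i
      have hi := hp i
      rw [zero_mul] at hi
      exact_mod_cast hi
    apply hnrat
    refine ⟨v, p, α / (α * α + β * β), -β / (c * (α * α + β * β)), β / (α * α + β * β),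
      α / (c * (α * α + β * β)), fun i => ⟨?_, ?_⟩⟩
    · rw [hv i, hp i, hw₀, div_mul_eq_mul_div, div_mul_eq_mul_div,
        div_add_div _ _ hr2 (mul_ne_zero hc hr2), eq_div_iff (mul_ne_zero hr2 (mul_ne_zero hc hr2))]
      ring
    · rw [hv i, hp i, hw₀, div_mul_eq_mul_div, div_mul_eq_mul_div,
        div_add_div _ _ hr2 (mul_ne_zero hc hr2), eq_div_iff (mul_ne_zero hr2 (mul_ne_zero hc hr2))]
      ring
  -- the density input: `g_k w₀ → w` with `g_k ∈ Γ_v`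
  obtain ⟨z, hzS, hz⟩ := mem_closure_iff_seq_limit.1 (hdense w₀ w h1 h2 h3 h4 h5)
  have hzS' : ∀ n, ∃ g : Matrix K3Index K3Index ℤ, g.transpose * k3Gram * g = k3Gram ∧
      g.det = 1 ∧ g *ᵥ v = v ∧ z n = g.map (Int.cast : ℤ → ℝ) *ᵥ w₀ := fun n => hzS n
  choose g hg hdet hgv hzg using hzS'
  -- `(α − iβ) x = v + i w₀`, `(α' − iβ') y = v + i w`, `g_k (v + i w₀) = v + i g_k w₀`
  have hxξ : (⟨α, -β⟩ : ℂ) • x = fun i => ((v i : ℝ) : ℂ) + (w₀ i : ℂ) * Complex.I := by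
    funext i
    apply Complex.ext
    · simp only [Pi.smul_apply, smul_eq_mul, Complex.mul_re, Complex.add_re, Complex.ofReal_re,
        Complex.ofReal_im, Complex.I_re, Complex.I_im]
      rw [hv i]
      ring
    · simp only [Pi.smul_apply, smul_eq_mul, Complex.mul_im, Complex.add_im, Complex.ofReal_re,
        Complex.ofReal_im, Complex.I_re, Complex.I_im, hw₀]
      ring
  have hyξ : (⟨α', -β'⟩ : ℂ) • y = fun i => ((v i : ℝ) : ℂ) + (w i : ℂ) * Complex.I := by
    funext i
    apply Complex.ext
    · simp only [Pi.smul_apply, smul_eq_mul, Complex.mul_re, Complex.add_re, Complex.ofReal_re,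
        Complex.ofReal_im, Complex.I_re, Complex.I_im]
      rw [hvy i]
      ring
    · simp only [Pi.smul_apply, smul_eq_mul, Complex.mul_im, Complex.add_im, Complex.ofReal_re,
        Complex.ofReal_im, Complex.I_re, Complex.I_im, hw]
      ring
  have hgξ : ∀ k, (g k).map (Int.cast : ℤ → ℂ) *ᵥ ((⟨α, -β⟩ : ℂ) • x) =
      fun i => ((v i : ℝ) : ℂ) + (z k i : ℂ) * Complex.I := by
    intro k
    rw [hxξ]
    funext i
    apply Complex.ext
    · rw [re_map_mulVec]
      have e : (fun j => ((((v j : ℝ) : ℂ) + (w₀ j : ℂ) * Complex.I)).re) = fun j => (v j : ℝ) := by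
        funext j
        simp
      rw [e, ← intCast_mulVec_apply, hgv k]
      simp
    · rw [im_map_mulVec]
      have e : (fun j => ((((v j : ℝ) : ℂ) + (w₀ j : ℂ) * Complex.I)).im) = w₀ := by
        funext j
        simp
      rw [e, ← congrFun (hzg k) i]
      simp
  -- the scalars
  have hs : (⟨α, -β⟩ : ℂ) ≠ 0 := by
    intro h
    have h1 := congrArg Complex.re h
    have h2 := congrArg Complex.im h
    simp only [Complex.zero_re, Complex.zero_im, neg_eq_zero] at h1 h2
    rw [h1, h2, mul_zero, add_zero] at hr
    exact lt_irrefl 0 hr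
  have hs' : (⟨α', -β'⟩ : ℂ) ≠ 0 := by
    intro h
    have h1 := congrArg Complex.re h
    have h2 := congrArg Complex.im h
    simp only [Complex.zero_re, Complex.zero_im, neg_eq_zero] at h1 h2
    rw [h1, h2, mul_zero, add_zero] at hr'
    exact lt_irrefl 0 hr'
  set t : ℂ := (⟨α', -β'⟩ : ℂ)⁻¹ * (⟨α, -β⟩ : ℂ) with ht
  have ht0 : t ≠ 0 := mul_ne_zero (inv_ne_zero hs') hs
  -- the continuous embedding `u ↦ v + i u`
  have hΦ : Continuous fun (u : K3Index → ℝ) (i : K3Index) => ((v i : ℝ) : ℂ) + (u i : ℂ) * Complex.I :=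
    continuous_pi fun i =>
      continuous_const.add ((Complex.continuous_ofReal.comp (continuous_apply i)).mul continuous_const)
  have hkey : (fun k => t • ((g k).map (Int.cast : ℤ → ℂ) *ᵥ x)) =
      fun k => (⟨α', -β'⟩ : ℂ)⁻¹ • (fun i => ((v i : ℝ) : ℂ) + (z k i : ℂ) * Complex.I) := by
    funext k
    rw [ht, mul_smul, ← Matrix.mulVec_smul, hgξ k]
  have hyw : y = (⟨α', -β'⟩ : ℂ)⁻¹ • (fun i => ((v i : ℝ) : ℂ) + (w i : ℂ) * Complex.I) := by
    rw [← hyξ, inv_smul_smul₀ hs']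
  have hT : Tendsto (fun k => t • ((g k).map (Int.cast : ℤ → ℂ) *ᵥ x)) atTop (𝓝 y) := by
    rw [hkey, hyw]
    exact ((hΦ.tendsto w).comp hz).const_smul _
  exact mem_closure_of_tendsto hT (Filter.Eventually.of_forall fun k => ⟨g k, t, hg k, hdet k, ht0, rfl⟩)

/-- **The named fact from its two Ratner-theoretic inputs.** Verbitsky's orbit-closure trichotomy
for `Λ_{K3}` (`Verbitsky2017_orbitClosure_trichotomy_K3`) follows from (ii) — the cone of every
period vector whose plane contains no rational vector is dense in `D` (the case `S = SO⁺(a,b)` of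
the printed proof) — together with, for every lattice vector `v ≠ 0`, the density of the
`Γ_v = Stab_{SO(Λ)}(v)`-orbit of every lattice-free direction `w₀ ⊥ v` of positive square in the
sphere `{w ⊥ v | (w.w) = (w₀.w₀)}` (the case `S = SO⁺(a−1,b) = Stab(v)`); conjuncts (i) and
(iii)(b) being unconditional (`mem_orbit_of_rationalPlane_of_mem_closure`,
`exists_latticeVector_of_mem_closure_orbit`) and (iii)(a) reducing to the second input
(`mem_closure_orbit_of_stabilizer_orbit_dense`). Neither input is proved here (Ratner's theorem).
WARNING: as stated — for EVERY `v ≠ 0`, isotropic `v` included — the second hypothesis is FALSE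
(`not_forall_stabilizer_orbit_dense`), so this assembly is vacuous; use
`Verbitsky2017_orbitClosure_trichotomy_K3_of_planeDense_of_posStabilizerDense` (density asked only
for `(v.v) > 0`).
[cite: Verbitsky2017ErgodicErratum, §2.3 Theorem (i)–(iii) and its proof, §2.1, §2.2] -/
theorem Verbitsky2017_orbitClosure_trichotomy_K3_of_planeDense_of_stabilizerDense
    (hdense : ∀ x : K3Index → ℂ, x ∈ k3PeriodDomain →
      (∀ v : K3Index → ℤ, (∃ a b : ℝ, ∀ i, (v i : ℝ) = a * (x i).re + b * (x i).im) → v = 0) →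
      ∀ y : K3Index → ℂ, y ∈ k3PeriodDomain →
        y ∈ closure {z : K3Index → ℂ | ∃ (g : Matrix K3Index K3Index ℤ) (t : ℂ),
          g.transpose * k3Gram * g = k3Gram ∧ g.det = 1 ∧ t ≠ 0 ∧
            z = t • (g.map (Int.cast : ℤ → ℂ) *ᵥ x)})
    (hstab : ∀ v : K3Index → ℤ, v ≠ 0 → ∀ w₀ w : K3Index → ℝ,
      Matrix.toBilin' (k3Gram.map (Int.cast : ℤ → ℝ)) (fun i => (v i : ℝ)) w₀ = 0 →
      Matrix.toBilin' (k3Gram.map (Int.cast : ℤ → ℝ)) (fun i => (v i : ℝ)) w = 0 →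
      0 < Matrix.toBilin' (k3Gram.map (Int.cast : ℤ → ℝ)) w₀ w₀ →
      Matrix.toBilin' (k3Gram.map (Int.cast : ℤ → ℝ)) w w =
        Matrix.toBilin' (k3Gram.map (Int.cast : ℤ → ℝ)) w₀ w₀ →
      (∀ (p : K3Index → ℤ) (c : ℝ), (∀ i, (p i : ℝ) = c * w₀ i) → p = 0) →
      w ∈ closure {z : K3Index → ℝ | ∃ g : Matrix K3Index K3Index ℤ,
        g.transpose * k3Gram * g = k3Gram ∧ g.det = 1 ∧ g *ᵥ v = v ∧
          z = g.map (Int.cast : ℤ → ℝ) *ᵥ w₀}) :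
    Verbitsky2017_orbitClosure_trichotomy_K3 :=
  Verbitsky2017_orbitClosure_trichotomy_K3_of_dense hdense
    fun _x hx v hv0 hvx hnrat _y hy hvy => by
      obtain ⟨_a, _b, hab⟩ := hvx
      obtain ⟨_a', _b', hab'⟩ := hvy
      exact mem_closure_orbit_of_stabilizer_orbit_dense hx hv0 hab hnrat (hstab v hv0) hy hab'

/-! ### The stabiliser-orbit density fails for isotropic `v`; the corrected assembly -/

/-- Values of the real K3 form on basis vectors: `(e_i . e_j) = Λ_{ij}`. [folklore] -/
theorem k3RForm_single_single (i j : K3Index) :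
    Matrix.toBilin' (k3Gram.map (Int.cast : ℤ → ℝ)) (Pi.single i 1) (Pi.single j 1) =
      (k3Gram i j : ℝ) := by
  rw [Matrix.toBilin'_single, Matrix.map_apply]

/-- **The stabiliser-orbit density hypothesis is FALSE for isotropic lattice vectors** (so the
hypothesis `hstab` of `Verbitsky2017_orbitClosure_trichotomy_K3_of_planeDense_of_stabilizerDense`,
which quantifies over all `v ≠ 0`, is not satisfiable and that assembly is vacuous; the corrected
assembly `Verbitsky2017_orbitClosure_trichotomy_K3_of_planeDense_of_posStabilizerDense` below asks
it only for `(v.v) > 0`, where it is the orbit-closure dichotomy for `SO⁺(1,19) ⊂ SO⁺(2,19)`).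
Witness in `Λ_{K3} = E₈(−1)² ⊕ U₁ ⊕ U₂ ⊕ U₃`: `v = e ∈ U₁` isotropic (`(e.e) = 0`), `u = e' + f' ∈ U₂`
(`(u.u) = 2`, `u ⊥ e`), `w₀ = u + √2 e` and `w = u + (√2 + ½) e`. Then `w₀, w ⊥ e`,
`(w₀.w₀) = (w.w) = 2 > 0`, the line `ℝ w₀` contains no lattice point but `0` (`√2 ∉ ℚ`), yet for
every `g ∈ SO(Λ)` with `g e = e` one has `g w₀ = g u + √2 e ∈ ℤ²² + √2 e`: the `Γ_e`-orbit of `w₀`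
lies in the closed set `{z | z_e ∈ ℤ + √2}`, which misses `w` (`w_e = √2 + ½`). (For isotropic `v`
the stabiliser `Stab(v)` is not reductive: its unipotent radical, the Eichler transvections
`E_{v,a}`, moves `w ⊥ v` only along `ℝ v`, by `(w.a)`, a discrete set of translations when the
image of `w` in `v^⊥/ℝ v` is rational.) [folklore] -/
theorem exists_isotropic_stabilizer_orbit_not_dense :
    ∃ (v : K3Index → ℤ) (w₀ w : K3Index → ℝ), v ≠ 0 ∧
      Matrix.toBilin' (k3Gram.map (Int.cast : ℤ → ℝ)) (fun i => (v i : ℝ)) (fun i => (v i : ℝ)) = 0 ∧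
      Matrix.toBilin' (k3Gram.map (Int.cast : ℤ → ℝ)) (fun i => (v i : ℝ)) w₀ = 0 ∧
      Matrix.toBilin' (k3Gram.map (Int.cast : ℤ → ℝ)) (fun i => (v i : ℝ)) w = 0 ∧
      0 < Matrix.toBilin' (k3Gram.map (Int.cast : ℤ → ℝ)) w₀ w₀ ∧
      Matrix.toBilin' (k3Gram.map (Int.cast : ℤ → ℝ)) w w =
        Matrix.toBilin' (k3Gram.map (Int.cast : ℤ → ℝ)) w₀ w₀ ∧
      (∀ (p : K3Index → ℤ) (c : ℝ), (∀ i, (p i : ℝ) = c * w₀ i) → p = 0) ∧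
      w ∉ closure {z : K3Index → ℝ | ∃ g : Matrix K3Index K3Index ℤ,
        g.transpose * k3Gram * g = k3Gram ∧ g.det = 1 ∧ g *ᵥ v = v ∧
          z = g.map (Int.cast : ℤ → ℝ) *ᵥ w₀} := by
  set B := Matrix.toBilin' (k3Gram.map (Int.cast : ℤ → ℝ)) with hB
  -- indices: `e` isotropic in `U₁`; `e', f'` the standard basis of `U₂`
  set i₀ : K3Index := Sum.inr (Sum.inl 0) with hi₀
  set i₁ : K3Index := Sum.inr (Sum.inr (Sum.inl 0)) with hi₁
  set i₂ : K3Index := Sum.inr (Sum.inr (Sum.inl 1)) with hi₂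
  have h01 : i₀ ≠ i₁ := by decide
  have h02 : i₀ ≠ i₂ := by decide
  have h12 : i₁ ≠ i₂ := by decide
  -- the lattice vectors `v = e`, `uZ = e' + f'` and their real vectors `e`, `u`
  obtain ⟨v, hv⟩ : ∃ v : K3Index → ℤ, v = Pi.single i₀ 1 := ⟨_, rfl⟩
  obtain ⟨uZ, huZ⟩ : ∃ uZ : K3Index → ℤ, uZ = Pi.single i₁ 1 + Pi.single i₂ 1 := ⟨_, rfl⟩
  obtain ⟨e, he⟩ : ∃ e : K3Index → ℝ, e = Pi.single i₀ 1 := ⟨_, rfl⟩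
  obtain ⟨u, hu⟩ : ∃ u : K3Index → ℝ, u = Pi.single i₁ 1 + Pi.single i₂ 1 := ⟨_, rfl⟩
  have hvR : (fun i => (v i : ℝ)) = e := by
    funext i
    by_cases h : i = i₀
    · subst h; simp [hv, he]
    · simp [hv, he, h]
  have huR : (fun i => (uZ i : ℝ)) = u := by
    funext i
    by_cases h1 : i = i₁
    · subst h1; simp [huZ, hu, h12]
    · by_cases h2 : i = i₂
      · subst h2; simp [huZ, hu, h12.symm]
      · simp [huZ, hu, h1, h2]
  have hei₀ : e i₀ = 1 := by simp [he]
  have hei₁ : e i₁ = 0 := by simp [he, h01.symm]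
  have hui₀ : u i₀ = 0 := by simp [hu, h01, h02]
  have hui₁ : u i₁ = 1 := by simp [hu, h12]
  -- Gram values: `(e.e) = 0`, `(e.u) = (u.e) = 0`, `(u.u) = 2`
  have hG : ∀ i j : K3Index, B (Pi.single i 1) (Pi.single j 1) = (k3Gram i j : ℝ) := fun i j => by
    rw [hB]; exact k3RForm_single_single i j
  have hee : B e e = 0 := by
    rw [he, hG]; exact_mod_cast (by decide : k3Gram i₀ i₀ = 0)
  have heu : B e u = 0 := by
    rw [he, hu, LinearMap.BilinForm.add_right, hG, hG]
    have h1 : k3Gram i₀ i₁ = 0 := by decide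
    have h2 : k3Gram i₀ i₂ = 0 := by decide
    rw [h1, h2]; norm_num
  have hue : B u e = 0 := by
    rw [he, hu, LinearMap.BilinForm.add_left, hG, hG]
    have h1 : k3Gram i₁ i₀ = 0 := by decide
    have h2 : k3Gram i₂ i₀ = 0 := by decide
    rw [h1, h2]; norm_num
  have huu : B u u = 2 := by
    rw [hu, LinearMap.BilinForm.add_left, LinearMap.BilinForm.add_right,
      LinearMap.BilinForm.add_right, hG, hG, hG, hG]
    have h1 : k3Gram i₁ i₁ = 0 := by decide
    have h2 : k3Gram i₁ i₂ = 1 := by decide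
    have h3 : k3Gram i₂ i₁ = 1 := by decide
    have h4 : k3Gram i₂ i₂ = 0 := by decide
    rw [h1, h2, h3, h4]; norm_num
  -- `e ⊥ u + s e` and `(u + s e . u + s e) = 2`
  have hBe : ∀ s : ℝ, B e (u + s • e) = 0 := fun s => by
    rw [LinearMap.BilinForm.add_right e u (s • e), LinearMap.BilinForm.smul_right s e e, heu, hee,
      mul_zero, add_zero]
  have hBsq : ∀ s : ℝ, B (u + s • e) (u + s • e) = 2 := fun s => by
    rw [LinearMap.BilinForm.add_left u (s • e) (u + s • e),
      LinearMap.BilinForm.add_right u u (s • e), LinearMap.BilinForm.add_right (s • e) u (s • e),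
      LinearMap.BilinForm.smul_right s u e, LinearMap.BilinForm.smul_left s e u,
      LinearMap.BilinForm.smul_left s e (s • e), LinearMap.BilinForm.smul_right s e e,
      huu, hue, heu, hee]
    ring
  refine ⟨v, u + Real.sqrt 2 • e, u + (Real.sqrt 2 + 1 / 2) • e, ?_, ?_, ?_, ?_, ?_, ?_, ?_, ?_⟩
  · -- `v ≠ 0`
    intro h0
    have := congrFun h0 i₀
    simp [hv] at this
  · rw [hvR]; exact hee
  · rw [hvR]; exact hBe _
  · rw [hvR]; exact hBe _
  · rw [hBsq]; norm_num
  · rw [hBsq, hBsq]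
  · -- `ℝ w₀` is lattice-free: `w₀ i₁ = 1` and `w₀ i₀ = √2`
    intro p c hp
    have hc : (p i₁ : ℝ) = c := by
      rw [hp i₁, Pi.add_apply, Pi.smul_apply, smul_eq_mul, hui₁, hei₁]; ring
    have h0 : (p i₀ : ℝ) = c * Real.sqrt 2 := by
      rw [hp i₀, Pi.add_apply, Pi.smul_apply, smul_eq_mul, hui₀, hei₀]; ring
    by_cases hc0 : p i₁ = 0
    · have hc' : c = 0 := by rw [← hc, hc0, Int.cast_zero]
      funext i
      have hi := hp i
      rw [hc', zero_mul] at hi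
      exact_mod_cast hi
    · exfalso
      rw [← hc] at h0
      exact (irrational_sqrt_two.intCast_mul hc0).ne_int (p i₀) h0.symm
  · -- the orbit lies in the closed set `{z | z i₀ ∈ ℤ + √2}`, which misses `w`
    have hT : IsClosed {z : K3Index → ℝ | z i₀ - Real.sqrt 2 ∈ Set.range (Int.cast : ℤ → ℝ)} :=
      Int.isClosedEmbedding_coe_real.isClosed_range.preimage
        ((continuous_apply i₀).sub continuous_const)
    have hsub : {z : K3Index → ℝ | ∃ g : Matrix K3Index K3Index ℤ,
        g.transpose * k3Gram * g = k3Gram ∧ g.det = 1 ∧ g *ᵥ v = v ∧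
          z = g.map (Int.cast : ℤ → ℝ) *ᵥ (u + Real.sqrt 2 • e)} ⊆
        {z : K3Index → ℝ | z i₀ - Real.sqrt 2 ∈ Set.range (Int.cast : ℤ → ℝ)} := by
      rintro z ⟨g, -, -, hgv, rfl⟩
      -- `g (u + √2 e) = g u + √2 g e = g u + √2 e`, and `g u` is a lattice vector
      have hge : g.map (Int.cast : ℤ → ℝ) *ᵥ e = e := by
        rw [← hvR]
        funext i
        rw [← intCast_mulVec_apply, hgv]
      refine ⟨(g *ᵥ uZ) i₀, ?_⟩
      rw [Matrix.mulVec_add, Matrix.mulVec_smul, hge, ← huR, Pi.add_apply,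
        ← intCast_mulVec_apply, Pi.smul_apply, smul_eq_mul, hei₀]
      ring
    intro hmem
    obtain ⟨m, hm⟩ := (hT.closure_subset_iff.2 hsub) hmem
    rw [Pi.add_apply, Pi.smul_apply, smul_eq_mul, hui₀, hei₀] at hm
    have h2 : ((2 * m : ℤ) : ℝ) = 1 := by push_cast; linarith
    have h3 : (2 * m : ℤ) = 1 := by exact_mod_cast h2
    omega

/-- **The all-`v` stabiliser-orbit density is refutable**: the hypothesis `hstab` of
`Verbitsky2017_orbitClosure_trichotomy_K3_of_planeDense_of_stabilizerDense` (density asked for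
EVERY lattice `v ≠ 0`, isotropic ones included) is false, by
`exists_isotropic_stabilizer_orbit_not_dense`. [folklore] -/
theorem not_forall_stabilizer_orbit_dense :
    ¬ ∀ v : K3Index → ℤ, v ≠ 0 → ∀ w₀ w : K3Index → ℝ,
      Matrix.toBilin' (k3Gram.map (Int.cast : ℤ → ℝ)) (fun i => (v i : ℝ)) w₀ = 0 →
      Matrix.toBilin' (k3Gram.map (Int.cast : ℤ → ℝ)) (fun i => (v i : ℝ)) w = 0 →
      0 < Matrix.toBilin' (k3Gram.map (Int.cast : ℤ → ℝ)) w₀ w₀ →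
      Matrix.toBilin' (k3Gram.map (Int.cast : ℤ → ℝ)) w w =
        Matrix.toBilin' (k3Gram.map (Int.cast : ℤ → ℝ)) w₀ w₀ →
      (∀ (p : K3Index → ℤ) (c : ℝ), (∀ i, (p i : ℝ) = c * w₀ i) → p = 0) →
      w ∈ closure {z : K3Index → ℝ | ∃ g : Matrix K3Index K3Index ℤ,
        g.transpose * k3Gram * g = k3Gram ∧ g.det = 1 ∧ g *ᵥ v = v ∧
          z = g.map (Int.cast : ℤ → ℝ) *ᵥ w₀} := by
  intro h
  obtain ⟨v, w₀, w, hv0, -, h1, h2, h3, h4, h5, hw⟩ := exists_isotropic_stabilizer_orbit_not_dense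
  exact hw (h v hv0 w₀ w h1 h2 h3 h4 h5)

/-- **The named fact from its two Ratner-theoretic inputs (corrected assembly).** Verbitsky's
orbit-closure trichotomy for `Λ_{K3}` (`Verbitsky2017_orbitClosure_trichotomy_K3`) follows from
(ii) — the cone of every period vector whose plane contains no rational vector is dense in `D`
(Ratner for `H = SO⁺(a−2,b) = SO⁺(1,19)` acting on `SO⁺(3,19)/Γ`, with `S = SO⁺(a,b)` forced by
total irrationality) — together with, for every lattice vector `v` of POSITIVE square, the density
of the `Γ_v = Stab_{SO(Λ)}(v)`-orbit of every lattice-free direction `w₀ ⊥ v` of positive square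
in the sphere `{w ⊥ v | (w.w) = (w₀.w₀)}` of `v^⊥ ≅ ℝ^{2,19}` (Ratner for the MAXIMAL connected
subgroup `SO⁺(1,19) = Stab(v,w₀)° ⊂ SO⁺(2,19) = Stab(v)°`, the intermediate subgroup
`S = SO⁺(a−1,b)` of the printed proof: the `Γ_v`-orbit of `w₀` is closed or dense, and closed
forces `ℝ w₀` rational by Borel density). Compared with
`Verbitsky2017_orbitClosure_trichotomy_K3_of_planeDense_of_stabilizerDense` the second input is
asked only for `(v.v) > 0` — for isotropic `v` it is false (`not_forall_stabilizer_orbit_dense`),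
and a lattice vector of a positive plane has positive square (`k3RForm_pos_of_inPlane`). Conjuncts
(i) and (iii)(b) are unconditional (`mem_orbit_of_rationalPlane_of_mem_closure`,
`exists_latticeVector_of_mem_closure_orbit`); (iii)(a) reduces to the second input
(`mem_closure_orbit_of_stabilizer_orbit_dense`). Neither input is proved here (Ratner's theorem).
[cite: Verbitsky2017ErgodicErratum, §2.3 Theorem (i)–(iii) and its proof, §2.1, §2.2] -/
theorem Verbitsky2017_orbitClosure_trichotomy_K3_of_planeDense_of_posStabilizerDense
    (hdense : ∀ x : K3Index → ℂ, x ∈ k3PeriodDomain →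
      (∀ v : K3Index → ℤ, (∃ a b : ℝ, ∀ i, (v i : ℝ) = a * (x i).re + b * (x i).im) → v = 0) →
      ∀ y : K3Index → ℂ, y ∈ k3PeriodDomain →
        y ∈ closure {z : K3Index → ℂ | ∃ (g : Matrix K3Index K3Index ℤ) (t : ℂ),
          g.transpose * k3Gram * g = k3Gram ∧ g.det = 1 ∧ t ≠ 0 ∧
            z = t • (g.map (Int.cast : ℤ → ℂ) *ᵥ x)})
    (hstab : ∀ v : K3Index → ℤ,
      0 < Matrix.toBilin' (k3Gram.map (Int.cast : ℤ → ℝ)) (fun i => (v i : ℝ)) (fun i => (v i : ℝ)) →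
      ∀ w₀ w : K3Index → ℝ,
      Matrix.toBilin' (k3Gram.map (Int.cast : ℤ → ℝ)) (fun i => (v i : ℝ)) w₀ = 0 →
      Matrix.toBilin' (k3Gram.map (Int.cast : ℤ → ℝ)) (fun i => (v i : ℝ)) w = 0 →
      0 < Matrix.toBilin' (k3Gram.map (Int.cast : ℤ → ℝ)) w₀ w₀ →
      Matrix.toBilin' (k3Gram.map (Int.cast : ℤ → ℝ)) w w =
        Matrix.toBilin' (k3Gram.map (Int.cast : ℤ → ℝ)) w₀ w₀ →
      (∀ (p : K3Index → ℤ) (c : ℝ), (∀ i, (p i : ℝ) = c * w₀ i) → p = 0) →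
      w ∈ closure {z : K3Index → ℝ | ∃ g : Matrix K3Index K3Index ℤ,
        g.transpose * k3Gram * g = k3Gram ∧ g.det = 1 ∧ g *ᵥ v = v ∧
          z = g.map (Int.cast : ℤ → ℝ) *ᵥ w₀}) :
    Verbitsky2017_orbitClosure_trichotomy_K3 :=
  Verbitsky2017_orbitClosure_trichotomy_K3_of_dense hdense
    fun _x hx v hv0 hvx hnrat _y hy hvy => by
      obtain ⟨_a, _b, hab⟩ := hvx
      obtain ⟨_a', _b', hab'⟩ := hvy
      exact mem_closure_orbit_of_stabilizer_orbit_dense hx hv0 hab hnrat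
        (hstab v (k3RForm_pos_of_inPlane rfl hx hv0 hab)) hy hab'

/-! ### One frame-level residual statement: the orbit closure contains the orbit of the pointwise
stabiliser of the rational part of the plane (`cl(Γ·x) ⊇ P_x·x`) -/

/-- A non-zero complex multiple of a period vector is a period vector (the case `g = 1` of
`smul_map_mulVec_mem_k3PeriodDomain`). [cite: Huybrechts2016K3, Ch. 6 Prop. 1.5] -/
theorem smul_mem_k3PeriodDomain {x : K3Index → ℂ} (hx : x ∈ k3PeriodDomain) {t : ℂ}
    (ht : t ≠ 0) : t • x ∈ k3PeriodDomain := by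
  have h := smul_map_mulVec_mem_k3PeriodDomain hx (g := 1) (by simp) ht
  rwa [Matrix.map_one (Int.cast : ℤ → ℂ) Int.cast_zero Int.cast_one, Matrix.one_mulVec] at h

/-- The closure of the cone `{t • g x}` of `x` is stable under non-zero scalars (the case `g = 1`
of `smul_map_mulVec_mem_closure_orbit`). [folklore] -/
theorem smul_mem_closure_cone {x y : K3Index → ℂ}
    (hcl : y ∈ closure {z : K3Index → ℂ | ∃ (g : Matrix K3Index K3Index ℤ) (t : ℂ),
      g.transpose * k3Gram * g = k3Gram ∧ g.det = 1 ∧ t ≠ 0 ∧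
        z = t • (g.map (Int.cast : ℤ → ℂ) *ᵥ x)})
    {t : ℂ} (ht : t ≠ 0) :
    t • y ∈ closure {z : K3Index → ℂ | ∃ (g : Matrix K3Index K3Index ℤ) (t : ℂ),
      g.transpose * k3Gram * g = k3Gram ∧ g.det = 1 ∧ t ≠ 0 ∧
        z = t • (g.map (Int.cast : ℤ → ℂ) *ᵥ x)} := by
  have h := smul_map_mulVec_mem_closure_orbit hcl (g := 1) (by simp) Matrix.det_one ht
  rwa [Matrix.map_one (Int.cast : ℤ → ℂ) Int.cast_zero Int.cast_one, Matrix.one_mulVec] at h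

/-- **Conjunct (ii) from the frame-level orbit-closure statement.** Assume the FRAME-LEVEL
orbit-closure statement for `Γ = SO(Λ_{K3})` on `D` (hypothesis `hframe`, NOT proved here): for
period vectors `x, y` with `(Re y)² = (Re x)²` such that every lattice vector of the plane
`P_x = ⟨Re x, Im x⟩` lies in `P_y` with the same coordinates (`v = a Re x + b Im x ⇒
v = a Re y + b Im y`), `y` is a limit of `Γ`-translates `g x` (no scalars). Then the cone of every
period vector whose plane contains no rational vector is dense in `D`: rescale the target `y` by
`λ = √((Re x)²/(Re y)²)`; the coordinate condition is vacuous (`v = 0` forces `a = b = 0`), so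
`λ y ∈ cl(Γ x) ⊆ cl(ℂˣ Γ x)` and the closure of the cone is `ℂˣ`-stable. (In print: the case
`S = SO⁺(a,b)` of the Ratner argument, §2.3.) [cite: Verbitsky2017ErgodicErratum, §2.3 Theorem (ii) and its proof] -/
theorem dense_of_frameOrbitClosure
    (hframe : ∀ x : K3Index → ℂ, x ∈ k3PeriodDomain → ∀ y : K3Index → ℂ, y ∈ k3PeriodDomain →
      Matrix.toBilin' (k3Gram.map (Int.cast : ℤ → ℝ)) (fun i => (y i).re) (fun i => (y i).re) =
        Matrix.toBilin' (k3Gram.map (Int.cast : ℤ → ℝ)) (fun i => (x i).re) (fun i => (x i).re) →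
      (∀ (v : K3Index → ℤ) (a b : ℝ), (∀ i, (v i : ℝ) = a * (x i).re + b * (x i).im) →
        ∀ i, (v i : ℝ) = a * (y i).re + b * (y i).im) →
      y ∈ closure {z : K3Index → ℂ | ∃ g : Matrix K3Index K3Index ℤ,
        g.transpose * k3Gram * g = k3Gram ∧ g.det = 1 ∧ z = g.map (Int.cast : ℤ → ℂ) *ᵥ x})
    {x : K3Index → ℂ} (hx : x ∈ k3PeriodDomain)
    (hirr : ∀ v : K3Index → ℤ, (∃ a b : ℝ, ∀ i, (v i : ℝ) = a * (x i).re + b * (x i).im) → v = 0)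
    {y : K3Index → ℂ} (hy : y ∈ k3PeriodDomain) :
    y ∈ closure {z : K3Index → ℂ | ∃ (g : Matrix K3Index K3Index ℤ) (t : ℂ),
      g.transpose * k3Gram * g = k3Gram ∧ g.det = 1 ∧ t ≠ 0 ∧
        z = t • (g.map (Int.cast : ℤ → ℂ) *ᵥ x)} := by
  set B := Matrix.toBilin' (k3Gram.map (Int.cast : ℤ → ℝ)) with hB
  obtain ⟨h12, h11, hpos⟩ := (mem_k3PeriodDomain_iff_k3RForm hB x).1 hx
  obtain ⟨-, -, hposy⟩ := (mem_k3PeriodDomain_iff_k3RForm hB y).1 hy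
  have h21 : B (fun i => (x i).im) (fun i => (x i).re) = 0 := by
    rw [hB, k3RForm_comm, ← hB]; exact h12
  -- the rescaling factor `l = √((Re x)² / (Re y)²)`
  have hq : 0 < B (fun i => (x i).re) (fun i => (x i).re) /
      B (fun i => (y i).re) (fun i => (y i).re) := div_pos hpos hposy
  set l : ℝ := Real.sqrt (B (fun i => (x i).re) (fun i => (x i).re) /
    B (fun i => (y i).re) (fun i => (y i).re)) with hl
  have hl0 : 0 < l := Real.sqrt_pos.2 hq
  have hll : l * l = B (fun i => (x i).re) (fun i => (x i).re) /
      B (fun i => (y i).re) (fun i => (y i).re) := Real.mul_self_sqrt hq.le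
  have hlC : (l : ℂ) ≠ 0 := Complex.ofReal_ne_zero.2 hl0.ne'
  have hy' : (l : ℂ) • y ∈ k3PeriodDomain := smul_mem_k3PeriodDomain hy hlC
  -- `(Re (l y))² = l² (Re y)² = (Re x)²`
  have hsize : B (fun i => (((l : ℂ) • y) i).re) (fun i => (((l : ℂ) • y) i).re) =
      B (fun i => (x i).re) (fun i => (x i).re) := by
    have e : (fun i => (((l : ℂ) • y) i).re) = l • fun i => (y i).re := funext fun i => by simp
    rw [e, LinearMap.BilinForm.smul_left, LinearMap.BilinForm.smul_right, ← mul_assoc, hll]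
    exact div_mul_cancel₀ _ hposy.ne'
  -- the coordinate condition is vacuous: `v = 0`, hence `a = b = 0`
  have hcoord : ∀ (v : K3Index → ℤ) (a b : ℝ), (∀ i, (v i : ℝ) = a * (x i).re + b * (x i).im) →
      ∀ i, (v i : ℝ) = a * (((l : ℂ) • y) i).re + b * (((l : ℂ) • y) i).im := by
    intro v a b hv
    have hv0 : v = 0 := hirr v ⟨a, b, hv⟩
    subst hv0
    have hvec : a • (fun i => (x i).re) + b • (fun i => (x i).im) = 0 := by
      funext i
      have hi := hv i
      simp only [Pi.zero_apply, Int.cast_zero] at hi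
      simp only [Pi.add_apply, Pi.smul_apply, smul_eq_mul, Pi.zero_apply]
      linarith
    have ea := congrArg (fun z => B z fun i => (x i).re) hvec
    have eb := congrArg (fun z => B z fun i => (x i).im) hvec
    simp only [LinearMap.BilinForm.add_left, LinearMap.BilinForm.smul_left, map_zero,
      LinearMap.zero_apply, h12, h21, mul_zero, add_zero, zero_add] at ea eb
    have ha : a = 0 := (mul_eq_zero.1 ea).resolve_right hpos.ne'
    have hb : b = 0 := by
      rw [← h11] at eb
      exact (mul_eq_zero.1 eb).resolve_right hpos.ne'
    intro i
    simp [ha, hb]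
  -- the frame statement, then back to `y` inside the closure of the cone
  have hcl := hframe x hx _ hy' hsize hcoord
  have hcl' : (l : ℂ) • y ∈ closure {z : K3Index → ℂ | ∃ (g : Matrix K3Index K3Index ℤ) (t : ℂ),
      g.transpose * k3Gram * g = k3Gram ∧ g.det = 1 ∧ t ≠ 0 ∧
        z = t • (g.map (Int.cast : ℤ → ℂ) *ᵥ x)} := by
    refine closure_mono ?_ hcl
    rintro z ⟨g, hg, hdet, rfl⟩
    exact ⟨g, 1, hg, hdet, one_ne_zero, (one_smul ℂ _).symm⟩
  have h := smul_mem_closure_cone hcl' (inv_ne_zero hlC)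
  rwa [inv_smul_smul₀ hlC] at h

/-- **Conjunct (iii), first inclusion, from the frame-level orbit-closure statement.** Under the
same frame-level hypothesis `hframe` (NOT proved here), if the non-zero lattice vector `v` lies in
the NON-rational plane of the period vector `x`, every period vector `y` whose plane contains `v`
lies in the closure of the cone of `x`. Glue: normalise both frames so that `v` is the first
frame vector, `x' = (α − iβ) x = v + i w₀`, `y' = (α' − iβ') y = v + i w` (then `(Re y')² =
(Re x')² = v²`); every lattice vector of `P_x` is commensurable with `v`
(`exists_smul_eq_smul_of_not_rationalPlane`), so it has the same coordinates `(m/n, 0)` in both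
frames; hence `y' ∈ cl(Γ x') ⊆ cl(ℂˣ Γ x)`, and the closure of the cone is `ℂˣ`-stable. (In print:
the case `S = SO⁺(a−1,b) = Stab(v)` of the Ratner argument, §2.3.)
[cite: Verbitsky2017ErgodicErratum, §2.3 Theorem (iii) and its proof, §2.1] -/
theorem mem_closure_orbit_of_frameOrbitClosure
    (hframe : ∀ x : K3Index → ℂ, x ∈ k3PeriodDomain → ∀ y : K3Index → ℂ, y ∈ k3PeriodDomain →
      Matrix.toBilin' (k3Gram.map (Int.cast : ℤ → ℝ)) (fun i => (y i).re) (fun i => (y i).re) =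
        Matrix.toBilin' (k3Gram.map (Int.cast : ℤ → ℝ)) (fun i => (x i).re) (fun i => (x i).re) →
      (∀ (v : K3Index → ℤ) (a b : ℝ), (∀ i, (v i : ℝ) = a * (x i).re + b * (x i).im) →
        ∀ i, (v i : ℝ) = a * (y i).re + b * (y i).im) →
      y ∈ closure {z : K3Index → ℂ | ∃ g : Matrix K3Index K3Index ℤ,
        g.transpose * k3Gram * g = k3Gram ∧ g.det = 1 ∧ z = g.map (Int.cast : ℤ → ℂ) *ᵥ x})
    {x : K3Index → ℂ} (hx : x ∈ k3PeriodDomain) {v : K3Index → ℤ} (hv0 : v ≠ 0) {α β : ℝ}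
    (hv : ∀ i, (v i : ℝ) = α * (x i).re + β * (x i).im)
    (hnrat : ¬ ∃ (u w : K3Index → ℤ) (a b c d : ℝ), ∀ i,
      (x i).re = a * u i + b * w i ∧ (x i).im = c * u i + d * w i)
    {y : K3Index → ℂ} (hy : y ∈ k3PeriodDomain) {α' β' : ℝ}
    (hvy : ∀ i, (v i : ℝ) = α' * (y i).re + β' * (y i).im) :
    y ∈ closure {z : K3Index → ℂ | ∃ (g : Matrix K3Index K3Index ℤ) (t : ℂ),
      g.transpose * k3Gram * g = k3Gram ∧ g.det = 1 ∧ t ≠ 0 ∧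
        z = t • (g.map (Int.cast : ℤ → ℂ) *ᵥ x)} := by
  set B := Matrix.toBilin' (k3Gram.map (Int.cast : ℤ → ℝ)) with hB
  -- `(α, β) ≠ 0`, `(α', β') ≠ 0`: the scalars `s = α − iβ`, `s' = α' − iβ'` are units
  have hr : 0 < α * α + β * β := by
    by_contra hle
    have ha : α = 0 := by nlinarith [mul_self_nonneg α, mul_self_nonneg β]
    have hb : β = 0 := by nlinarith [mul_self_nonneg α, mul_self_nonneg β]
    apply hv0
    funext i
    have hi := hv i
    rw [ha, hb, zero_mul, zero_mul, add_zero] at hi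
    exact_mod_cast hi
  have hr' : 0 < α' * α' + β' * β' := by
    by_contra hle
    have ha : α' = 0 := by nlinarith [mul_self_nonneg α', mul_self_nonneg β']
    have hb : β' = 0 := by nlinarith [mul_self_nonneg α', mul_self_nonneg β']
    apply hv0
    funext i
    have hi := hvy i
    rw [ha, hb, zero_mul, zero_mul, add_zero] at hi
    exact_mod_cast hi
  have hs : (⟨α, -β⟩ : ℂ) ≠ 0 := by
    intro h
    have h1 := congrArg Complex.re h
    have h2 := congrArg Complex.im h
    simp only [Complex.zero_re, Complex.zero_im, neg_eq_zero] at h1 h2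
    rw [h1, h2, mul_zero, add_zero] at hr
    exact lt_irrefl 0 hr
  have hs' : (⟨α', -β'⟩ : ℂ) ≠ 0 := by
    intro h
    have h1 := congrArg Complex.re h
    have h2 := congrArg Complex.im h
    simp only [Complex.zero_re, Complex.zero_im, neg_eq_zero] at h1 h2
    rw [h1, h2, mul_zero, add_zero] at hr'
    exact lt_irrefl 0 hr'
  -- the normalised frames `x' = s x = v + i w₀`, `y' = s' y = v + i w`
  set x' : K3Index → ℂ := (⟨α, -β⟩ : ℂ) • x with hx'd
  set y' : K3Index → ℂ := (⟨α', -β'⟩ : ℂ) • y with hy'd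
  have hx' : x' ∈ k3PeriodDomain := smul_mem_k3PeriodDomain hx hs
  have hy' : y' ∈ k3PeriodDomain := smul_mem_k3PeriodDomain hy hs'
  have hrex : ∀ i, (x' i).re = (v i : ℝ) := fun i => by
    simp only [hx'd, Pi.smul_apply, smul_eq_mul, Complex.mul_re]
    rw [hv i]
    ring
  have himx : ∀ i, (x' i).im = -β * (x i).re + α * (x i).im := fun i => by
    simp only [hx'd, Pi.smul_apply, smul_eq_mul, Complex.mul_im]
    ring
  have hrey : ∀ i, (y' i).re = (v i : ℝ) := fun i => by
    simp only [hy'd, Pi.smul_apply, smul_eq_mul, Complex.mul_re]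
    rw [hvy i]
    ring
  -- same size: both real parts are `v`
  have hsize : B (fun i => (y' i).re) (fun i => (y' i).re) =
      B (fun i => (x' i).re) (fun i => (x' i).re) := by
    rw [show (fun i => (y' i).re) = fun i => (x' i).re from funext fun i => by rw [hrey, hrex]]
  -- same coordinates: every lattice vector of `P_x` is `(m/n) v = (m/n) Re x' = (m/n) Re y'`
  obtain ⟨h12', h11', hpos'⟩ := (mem_k3PeriodDomain_iff_k3RForm hB x').1 hx'
  have h21' : B (fun i => (x' i).im) (fun i => (x' i).re) = 0 := by
    rw [hB, k3RForm_comm, ← hB]; exact h12'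
  have hcoord : ∀ (u : K3Index → ℤ) (a b : ℝ), (∀ i, (u i : ℝ) = a * (x' i).re + b * (x' i).im) →
      ∀ i, (u i : ℝ) = a * (y' i).re + b * (y' i).im := by
    intro u a b hu
    have hu' : ∀ i, (u i : ℝ) = (a * α - b * β) * (x i).re + (a * β + b * α) * (x i).im :=
      fun i => by rw [hu i, hrex i, himx i, hv i]; ring
    obtain ⟨m, n, hn, hmn⟩ := exists_smul_eq_smul_of_not_rationalPlane hv0 hv hu' hnrat
    have hnR : (n : ℝ) ≠ 0 := Int.cast_ne_zero.2 hn
    have hun : ∀ i, (u i : ℝ) = (m : ℝ) / n * (x' i).re := fun i => by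
      have h := congrFun hmn i
      simp only [Pi.smul_apply, smul_eq_mul] at h
      have h' : (n : ℝ) * u i = m * v i := by exact_mod_cast h
      rw [hrex i, div_mul_eq_mul_div, eq_div_iff hnR]
      linear_combination h'
    -- `a = m / n` and `b = 0`, testing against the orthogonal frame `(Re x', Im x')`
    have hvec : (a - (m : ℝ) / n) • (fun i => (x' i).re) + b • (fun i => (x' i).im) = 0 := by
      funext i
      simp only [Pi.add_apply, Pi.smul_apply, smul_eq_mul, Pi.zero_apply]
      have h1 := hu i
      have h2 := hun i
      linear_combination h2 - h1
    have ea := congrArg (fun z => B z fun i => (x' i).re) hvec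
    have eb := congrArg (fun z => B z fun i => (x' i).im) hvec
    simp only [LinearMap.BilinForm.add_left, LinearMap.BilinForm.smul_left, map_zero,
      LinearMap.zero_apply, h12', h21', mul_zero, add_zero, zero_add] at ea eb
    have ha : a - (m : ℝ) / n = 0 := (mul_eq_zero.1 ea).resolve_right hpos'.ne'
    have hb : b = 0 := by
      rw [← h11'] at eb
      exact (mul_eq_zero.1 eb).resolve_right hpos'.ne'
    intro i
    rw [hun i, hrex i, ← hrey i, hb, zero_mul, add_zero, show (m : ℝ) / n = a by linarith]
  -- the frame statement for `(x', y')`, then back to `y` inside the closure of the cone of `x`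
  have hcl := hframe x' hx' y' hy' hsize hcoord
  have hcl' : y' ∈ closure {z : K3Index → ℂ | ∃ (g : Matrix K3Index K3Index ℤ) (t : ℂ),
      g.transpose * k3Gram * g = k3Gram ∧ g.det = 1 ∧ t ≠ 0 ∧
        z = t • (g.map (Int.cast : ℤ → ℂ) *ᵥ x)} := by
    refine closure_mono ?_ hcl
    rintro z ⟨g, hg, hdet, rfl⟩
    exact ⟨g, ⟨α, -β⟩, hg, hdet, hs, by rw [hx'd, Matrix.mulVec_smul]⟩
  have h := smul_mem_closure_cone hcl' (inv_ne_zero hs')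
  rwa [hy'd, inv_smul_smul₀ hs'] at h

/-- **The frame-level statement holds (trivially) at rational planes**: if `P_x` is rational,
the only period vector `y` with `(Re y)² = (Re x)²` in whose frame every lattice vector of `P_x`
keeps its coordinates is `y = x` itself (the lattice vectors span `P_x`), which lies in its own
`Γ`-orbit. So the hypothesis `hframe` of
`Verbitsky2017_orbitClosure_trichotomy_K3_of_frameOrbitClosure` has content only at irrational
planes (Ratner's cases `S = Stab(v)` and `S = SO⁺(a,b)`). [folklore] -/
theorem frameOrbitClosure_of_rationalPlane {x : K3Index → ℂ} (hx : x ∈ k3PeriodDomain)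
    (hrat : ∃ (u w : K3Index → ℤ) (a b c d : ℝ), ∀ i,
      (x i).re = a * u i + b * w i ∧ (x i).im = c * u i + d * w i)
    {y : K3Index → ℂ}
    (hcoord : ∀ (v : K3Index → ℤ) (a b : ℝ), (∀ i, (v i : ℝ) = a * (x i).re + b * (x i).im) →
      ∀ i, (v i : ℝ) = a * (y i).re + b * (y i).im) :
    y ∈ closure {z : K3Index → ℂ | ∃ g : Matrix K3Index K3Index ℤ,
      g.transpose * k3Gram * g = k3Gram ∧ g.det = 1 ∧ z = g.map (Int.cast : ℤ → ℂ) *ᵥ x} := by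
  set B := Matrix.toBilin' (k3Gram.map (Int.cast : ℤ → ℝ)) with hB
  obtain ⟨h12, h11, hpos⟩ := (mem_k3PeriodDomain_iff_k3RForm hB x).1 hx
  have h21 : B (fun i => (x i).im) (fun i => (x i).re) = 0 := by
    rw [hB, k3RForm_comm, ← hB]; exact h12
  obtain ⟨u, w, a, b, c, d, h⟩ := hrat
  obtain ⟨⟨α, β, hu⟩, ⟨γ, δ, hw⟩⟩ := exists_inPlane_of_rationalPlane hx h
  have huy := hcoord u α β hu
  have hwy := hcoord w γ δ hw
  -- `Re x = (aα + bγ) Re x + (aβ + bδ) Im x`, so `aα + bγ = 1`, `aβ + bδ = 0`; similarly for `Im x`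
  have hre : (fun i => (x i).re) =
      (a * α + b * γ) • (fun i => (x i).re) + (a * β + b * δ) • (fun i => (x i).im) := by
    funext i
    simp only [Pi.add_apply, Pi.smul_apply, smul_eq_mul]
    have h1 := (h i).1
    rw [hu i, hw i] at h1
    linear_combination h1
  have him : (fun i => (x i).im) =
      (c * α + d * γ) • (fun i => (x i).re) + (c * β + d * δ) • (fun i => (x i).im) := by
    funext i
    simp only [Pi.add_apply, Pi.smul_apply, smul_eq_mul]
    have h2 := (h i).2
    rw [hu i, hw i] at h2
    linear_combination h2
  have e1 := congrArg (fun z => B z fun i => (x i).re) hre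
  have e2 := congrArg (fun z => B z fun i => (x i).im) hre
  have e3 := congrArg (fun z => B z fun i => (x i).re) him
  have e4 := congrArg (fun z => B z fun i => (x i).im) him
  simp only [LinearMap.BilinForm.add_left, LinearMap.BilinForm.smul_left, h12, h21, mul_zero,
    add_zero, zero_add] at e1 e2 e3 e4
  rw [← h11] at e2 e4
  have hc0 : B (fun i => (x i).re) (fun i => (x i).re) ≠ 0 := hpos.ne'
  have k1 : a * α + b * γ = 1 := by
    have : (a * α + b * γ - 1) * B (fun i => (x i).re) (fun i => (x i).re) = 0 := by
      linear_combination -e1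
    exact sub_eq_zero.1 ((mul_eq_zero.1 this).resolve_right hc0)
  have k2 : a * β + b * δ = 0 := (mul_eq_zero.1 e2.symm).resolve_right hc0
  have k3 : c * α + d * γ = 0 := (mul_eq_zero.1 e3.symm).resolve_right hc0
  have k4 : c * β + d * δ = 1 := by
    have : (c * β + d * δ - 1) * B (fun i => (x i).re) (fun i => (x i).re) = 0 := by
      linear_combination -e4
    exact sub_eq_zero.1 ((mul_eq_zero.1 this).resolve_right hc0)
  -- hence `y = x`
  have hyx : y = x := by
    funext i
    apply Complex.ext
    · have h1 := (h i).1
      rw [huy i, hwy i] at h1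
      -- h1 : (x i).re = a (α Re y + β Im y) + b (γ Re y + δ Im y)
      have : (x i).re = (a * α + b * γ) * (y i).re + (a * β + b * δ) * (y i).im := by
        linear_combination h1
      rw [this, k1, k2]
      ring
    · have h2 := (h i).2
      rw [huy i, hwy i] at h2
      have : (x i).im = (c * α + d * γ) * (y i).re + (c * β + d * δ) * (y i).im := by
        linear_combination h2
      rw [this, k3, k4]
      ring
  rw [hyx]
  refine subset_closure ⟨1, by simp, Matrix.det_one, ?_⟩
  rw [Matrix.map_one (Int.cast : ℤ → ℂ) Int.cast_zero Int.cast_one, Matrix.one_mulVec]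

/-- **The named fact from ONE frame-level orbit-closure statement (Ratner's conclusion with the
Ratner group identified).** Verbitsky's orbit-closure trichotomy for `Λ_{K3}`
(`Verbitsky2017_orbitClosure_trichotomy_K3`) follows from the single hypothesis `hframe`: for
period vectors `x, y ∈ D` with `(Re y)² = (Re x)²` such that every lattice vector of
`P_x = ⟨Re x, Im x⟩` lies in `P_y` with the same coordinates, `y ∈ cl(SO(Λ_{K3}) · x)` (orbit of
the VECTOR `x`, no scalars). Writing `T_x` for this set of `y`, `T_x = P_x · x` for
`P_x ⊂ SO⁺(3,19)` the identity component of the pointwise stabiliser of `P_x ∩ Λ` (transitivity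
of `SO⁺(3,19)`, resp. `Stab(v)° ≅ SO⁺(2,19)`, on the connected level sets of conformal orthogonal
positive frames), so `hframe` reads `cl(Γ·x) ⊇ P_x·x` — Ratner's orbit-closure theorem
`cl(Γ g H) = Γ g S` for the unipotent-generated `H = SO⁺(1,19) = Stab(Re x, Im x)°` acting on
`SO(3,19)/SO(Λ_{K3})` (§2.2; `SO(Λ_{K3})` is a lattice by Borel–Harish-Chandra), with the
intermediate closed connected subgroup `S ⊇ H` pinned down by the classification
`S ∈ {H, H·SO(2), Stab(ℓ)° (ℓ ⊂ P_x a line), SO⁺(3,19)}` (§2.1) and Borel density (`S ∩ Γ^g` a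
lattice in `S` forces `P_x`, resp. `ℓ`, to be rational): `S = H` or `H·SO(2)` iff `P_x` is
rational (then `T_x = {x}`, and `hframe` holds trivially: `frameOrbitClosure_of_rationalPlane`),
`S = Stab(v)°` iff `P_x ∩ Λ_ℚ = ℚ v`, `S = SO⁺(3,19)` iff `P_x` is totally irrational. This
replaces the two inputs of `Verbitsky2017_orbitClosure_trichotomy_K3_of_planeDense_of_posStabilizerDense`
((ii) on `Gr₊₊(Λ_ℝ)` and, for every positive lattice `v`, an orbit density on the second
homogeneous space `Stab(v)°/H ≅ SO⁺(2,19)/SO⁺(1,19)` with the second lattice `Stab_Γ(v)`) by one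
statement about one homogeneous space. Glue: (ii) is `dense_of_frameOrbitClosure`, (iii)(a) is
`mem_closure_orbit_of_frameOrbitClosure`, (i) and (iii)(b) are unconditional
(`Verbitsky2017_orbitClosure_trichotomy_K3_of_dense`). `hframe` itself is NOT proved here
(Ratner's theorem, Borel–Harish-Chandra, Borel density and the Lie correspondence are not in
Mathlib). [cite: Verbitsky2017ErgodicErratum, §2.3 Theorem (i)–(iii) and its proof, §2.1 Theorem, §2.2 Theorem] -/
theorem Verbitsky2017_orbitClosure_trichotomy_K3_of_frameOrbitClosure
    (hframe : ∀ x : K3Index → ℂ, x ∈ k3PeriodDomain → ∀ y : K3Index → ℂ, y ∈ k3PeriodDomain →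
      Matrix.toBilin' (k3Gram.map (Int.cast : ℤ → ℝ)) (fun i => (y i).re) (fun i => (y i).re) =
        Matrix.toBilin' (k3Gram.map (Int.cast : ℤ → ℝ)) (fun i => (x i).re) (fun i => (x i).re) →
      (∀ (v : K3Index → ℤ) (a b : ℝ), (∀ i, (v i : ℝ) = a * (x i).re + b * (x i).im) →
        ∀ i, (v i : ℝ) = a * (y i).re + b * (y i).im) →
      y ∈ closure {z : K3Index → ℂ | ∃ g : Matrix K3Index K3Index ℤ,
        g.transpose * k3Gram * g = k3Gram ∧ g.det = 1 ∧ z = g.map (Int.cast : ℤ → ℂ) *ᵥ x}) :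
    Verbitsky2017_orbitClosure_trichotomy_K3 :=
  Verbitsky2017_orbitClosure_trichotomy_K3_of_dense
    (fun _x hx hirr _y hy => dense_of_frameOrbitClosure hframe hx hirr hy)
    fun _x hx v hv0 hvx hnrat _y hy hvy => by
      obtain ⟨_a, _b, hab⟩ := hvx
      obtain ⟨_a', _b', hab'⟩ := hvy
      exact mem_closure_orbit_of_frameOrbitClosure hframe hx hv0 hab hnrat hy hab'

/-! ### The frame-level orbit closure lies in `Γ·T_x` unconditionally, and under the frame
statement it is exactly `Γ·T_x` -/

/-- Transport of coordinates by an integral matrix: if `v = a Re x + b Im x` then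
`g v = a Re (g x) + b Im (g x)`. [folklore] -/
theorem intCast_mulVec_eq_of_inPlane {x : K3Index → ℂ} {v : K3Index → ℤ} {a b : ℝ}
    (hv : ∀ i, (v i : ℝ) = a * (x i).re + b * (x i).im) (g : Matrix K3Index K3Index ℤ)
    (i : K3Index) :
    ((g *ᵥ v) i : ℝ) = a * ((g.map (Int.cast : ℤ → ℂ) *ᵥ x) i).re +
      b * ((g.map (Int.cast : ℤ → ℂ) *ᵥ x) i).im := by
  have hvR : (fun j => (v j : ℝ)) = a • (fun j => (x j).re) + b • (fun j => (x j).im) := by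
    funext j
    simp [hv j]
  rw [intCast_mulVec_apply, hvR, Matrix.mulVec_add, Matrix.mulVec_smul, Matrix.mulVec_smul,
    re_map_mulVec, im_map_mulVec]
  simp only [Pi.add_apply, Pi.smul_apply, smul_eq_mul]

/-- **The `SO(Λ_{K3})`-orbit closure of a period VECTOR stays in its level set of `D`**: every
`y ∈ cl(Γ·x)` is a period vector with `(Re y)² = (Re x)²` (integral isometries preserve the real
form, and the three conditions are closed). [cite: Huybrechts2016K3, Ch. 6 Prop. 1.5] -/
theorem mem_k3PeriodDomain_of_mem_closure_orbit {x : K3Index → ℂ} (hx : x ∈ k3PeriodDomain)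
    {y : K3Index → ℂ}
    (hcl : y ∈ closure {z : K3Index → ℂ | ∃ g : Matrix K3Index K3Index ℤ,
      g.transpose * k3Gram * g = k3Gram ∧ g.det = 1 ∧ z = g.map (Int.cast : ℤ → ℂ) *ᵥ x}) :
    y ∈ k3PeriodDomain ∧
      Matrix.toBilin' (k3Gram.map (Int.cast : ℤ → ℝ)) (fun i => (y i).re) (fun i => (y i).re) =
        Matrix.toBilin' (k3Gram.map (Int.cast : ℤ → ℝ)) (fun i => (x i).re) (fun i => (x i).re) := by
  set B := Matrix.toBilin' (k3Gram.map (Int.cast : ℤ → ℝ)) with hB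
  obtain ⟨h12, h11, hpos⟩ := (mem_k3PeriodDomain_iff_k3RForm hB x).1 hx
  have h1 : Continuous fun z : K3Index → ℂ => B (fun i => (z i).re) (fun i => (z i).im) := by
    rw [hB]
    simp only [k3RForm_apply]
    fun_prop
  have h2 : Continuous fun z : K3Index → ℂ => B (fun i => (z i).re) (fun i => (z i).re) := by
    rw [hB]
    simp only [k3RForm_apply]
    fun_prop
  have h3 : Continuous fun z : K3Index → ℂ => B (fun i => (z i).im) (fun i => (z i).im) := by
    rw [hB]
    simp only [k3RForm_apply]
    fun_prop
  have hclosed : IsClosed {z : K3Index → ℂ | B (fun i => (z i).re) (fun i => (z i).im) = 0 ∧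
      B (fun i => (z i).re) (fun i => (z i).re) = B (fun i => (x i).re) (fun i => (x i).re) ∧
      B (fun i => (z i).im) (fun i => (z i).im) = B (fun i => (x i).re) (fun i => (x i).re)} :=
    (isClosed_eq h1 continuous_const).inter
      ((isClosed_eq h2 continuous_const).inter (isClosed_eq h3 continuous_const))
  have hsub : {z : K3Index → ℂ | ∃ g : Matrix K3Index K3Index ℤ,
      g.transpose * k3Gram * g = k3Gram ∧ g.det = 1 ∧ z = g.map (Int.cast : ℤ → ℂ) *ᵥ x} ⊆
      {z : K3Index → ℂ | B (fun i => (z i).re) (fun i => (z i).im) = 0 ∧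
        B (fun i => (z i).re) (fun i => (z i).re) = B (fun i => (x i).re) (fun i => (x i).re) ∧
        B (fun i => (z i).im) (fun i => (z i).im) = B (fun i => (x i).re) (fun i => (x i).re)} := by
    rintro z ⟨g, hg, -, rfl⟩
    have er : (fun i => ((g.map (Int.cast : ℤ → ℂ) *ᵥ x) i).re) =
        g.map (Int.cast : ℤ → ℝ) *ᵥ fun j => (x j).re := funext fun i => re_map_mulVec g x i
    have ei : (fun i => ((g.map (Int.cast : ℤ → ℂ) *ᵥ x) i).im) =
        g.map (Int.cast : ℤ → ℝ) *ᵥ fun j => (x j).im := funext fun i => im_map_mulVec g x i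
    simp only [Set.mem_setOf_eq]
    rw [er, ei, k3RForm_mulVec_mulVec hB hg, k3RForm_mulVec_mulVec hB hg,
      k3RForm_mulVec_mulVec hB hg]
    exact ⟨h12, rfl, h11.symm⟩
  obtain ⟨e1, e2, e3⟩ := (hclosed.closure_subset_iff.2 hsub) hcl
  refine ⟨(mem_k3PeriodDomain_iff_k3RForm hB y).2 ⟨e1, e2.trans e3.symm, ?_⟩, e2⟩
  rw [e2]
  exact hpos

/-- **The frame-level orbit closure lies in `Γ·T_x` (unconditionally).** For a period vector `x`
and `y ∈ cl(SO(Λ_{K3})·x)` there is `γ ∈ SO(Λ_{K3})` carrying every lattice vector `v` of the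
plane `P_x` to a lattice vector `γ v` of `P_y` with the SAME coordinates (`v = a Re x + b Im x ⇒
γ v = a Re y + b Im y`); i.e. `γ⁻¹ y ∈ T_x`, the set of period vectors of the same size in whose
frame the lattice vectors of `P_x` keep their coordinates. With (i) and (iii)(b) this is the
frame-level form of the elementary half of the trichotomy (discreteness of `Λ` only: along
`g_k x → y` the bounded lattice vectors `g_k v` are frequently constant — jointly for a lattice
basis of `P_x` in the rational case, for the generator of `P_x ∩ Λ_ℚ = ℚ v₀` in the intermediate
case — and a fixed vector keeps fixed coordinates in the limit); the frame statement `hframe` of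
`Verbitsky2017_orbitClosure_trichotomy_K3_of_frameOrbitClosure` is the converse inclusion
`T_x ⊆ cl(Γ·x)`. [cite: Verbitsky2017ErgodicErratum, §2.3 Theorem (i), (iii) and its proof] -/
theorem exists_orbit_frame_of_mem_closure_orbit {x : K3Index → ℂ} (hx : x ∈ k3PeriodDomain)
    {y : K3Index → ℂ}
    (hcl : y ∈ closure {z : K3Index → ℂ | ∃ g : Matrix K3Index K3Index ℤ,
      g.transpose * k3Gram * g = k3Gram ∧ g.det = 1 ∧ z = g.map (Int.cast : ℤ → ℂ) *ᵥ x}) :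
    ∃ γ : Matrix K3Index K3Index ℤ, γ.transpose * k3Gram * γ = k3Gram ∧ γ.det = 1 ∧
      ∀ (v : K3Index → ℤ) (a b : ℝ), (∀ i, (v i : ℝ) = a * (x i).re + b * (x i).im) →
        ∀ i, ((γ *ᵥ v) i : ℝ) = a * (y i).re + b * (y i).im := by
  set B := Matrix.toBilin' (k3Gram.map (Int.cast : ℤ → ℝ)) with hB
  have hy : y ∈ k3PeriodDomain := (mem_k3PeriodDomain_of_mem_closure_orbit hx hcl).1
  obtain ⟨yk, hmem, hlim⟩ := mem_closure_iff_seq_limit.1 hcl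
  have hmem' : ∀ n, ∃ g : Matrix K3Index K3Index ℤ, g.transpose * k3Gram * g = k3Gram ∧
      g.det = 1 ∧ yk n = g.map (Int.cast : ℤ → ℂ) *ᵥ x := fun n => hmem n
  choose g hg hdet hyk using hmem'
  have hD : ∀ k, yk k ∈ k3PeriodDomain := fun k => by
    rw [hyk k, ← one_smul ℂ ((g k).map (Int.cast : ℤ → ℂ) *ᵥ x)]
    exact smul_map_mulVec_mem_k3PeriodDomain hx (hg k) one_ne_zero
  -- coordinates are transported along the sequence: `g_k v = a Re y_k + b Im y_k`
  have hco : ∀ k (v : K3Index → ℤ) (a b : ℝ), (∀ i, (v i : ℝ) = a * (x i).re + b * (x i).im) →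
      ∀ i, ((g k *ᵥ v) i : ℝ) = a * (yk k i).re + b * (yk k i).im := fun k v a b hv i => by
    rw [hyk k]
    exact intCast_mulVec_eq_of_inPlane hv (g k) i
  have hQ : ∀ (p : K3Index → ℤ) k, B (fun i => ((g k *ᵥ p) i : ℝ)) (fun i => ((g k *ᵥ p) i : ℝ)) =
      B (fun i => (p i : ℝ)) (fun i => (p i : ℝ)) := fun p k => by
    have hc : (fun i => ((g k *ᵥ p) i : ℝ)) = (g k).map (Int.cast : ℤ → ℝ) *ᵥ fun i => (p i : ℝ) :=
      funext fun i => intCast_mulVec_apply (g k) p i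
    rw [hc, k3RForm_mulVec_mulVec hB (hg k)]
  -- one index `K` such that, frequently in `k`, `g_k` agrees with `g_K` on `P_x ∩ Λ`
  have hK : ∃ K, ∃ᶠ k in atTop, ∀ v : K3Index → ℤ,
      (∃ a b : ℝ, ∀ i, (v i : ℝ) = a * (x i).re + b * (x i).im) → g k *ᵥ v = g K *ᵥ v := by
    by_cases hrat : ∃ (u w : K3Index → ℤ) (a b c d : ℝ), ∀ i,
        (x i).re = a * u i + b * w i ∧ (x i).im = c * u i + d * w i
    · -- rational plane: pigeonhole on the pair `(g_k u, g_k w)`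
      obtain ⟨u, w, a, b, c, d, hr⟩ := hrat
      obtain ⟨⟨αu, βu, hu⟩, ⟨αw, βw, hw⟩⟩ := exists_inPlane_of_rationalPlane hx hr
      obtain ⟨m, hm⟩ := eventually_latticeVector_mem_Icc hB hlim hy hD
        (max (B (fun i => (u i : ℝ)) (fun i => (u i : ℝ))) (B (fun i => (w i : ℝ)) (fun i => (w i : ℝ))))
      have hev : ∀ᶠ k in atTop, (g k *ᵥ u, g k *ᵥ w) ∈
          (Set.pi Set.univ (fun _ : K3Index => Set.Icc (-m) m)) ×ˢ
            (Set.pi Set.univ (fun _ : K3Index => Set.Icc (-m) m)) := by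
        filter_upwards [hm] with k hk
        exact ⟨fun i _ => hk _ αu βu (hco k u αu βu hu) ((hQ u k).le.trans (le_max_left _ _)) i,
          fun i _ => hk _ αw βw (hco k w αw βw hw) ((hQ w k).le.trans (le_max_right _ _)) i⟩
      obtain ⟨q, -, hfr⟩ := exists_frequently_eq_of_eventually_mem
        ((Set.Finite.pi fun _ => Set.finite_Icc (-m) m).prod
          (Set.Finite.pi fun _ => Set.finite_Icc (-m) m)) hev
      obtain ⟨K, hK⟩ := hfr.exists
      refine ⟨K, hfr.mono fun k hk v hv => ?_⟩
      obtain ⟨a₀, b₀, hv⟩ := hv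
      have hkK := hk.trans hK.symm
      simp only [Prod.mk.injEq] at hkK
      obtain ⟨e1, e2⟩ := hkK
      -- `v = p u + r w` over `ℝ`, hence `g_k v = p g_k u + r g_k w`
      have hvR : (fun i => (v i : ℝ)) =
          (a₀ * a + b₀ * c) • (fun i => (u i : ℝ)) + (a₀ * b + b₀ * d) • (fun i => (w i : ℝ)) := by
        funext i
        simp only [Pi.add_apply, Pi.smul_apply, smul_eq_mul]
        rw [hv i, (hr i).1, (hr i).2]
        ring
      have key : ∀ k', (fun i => ((g k' *ᵥ v) i : ℝ)) =
          (a₀ * a + b₀ * c) • (fun i => ((g k' *ᵥ u) i : ℝ)) +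
            (a₀ * b + b₀ * d) • (fun i => ((g k' *ᵥ w) i : ℝ)) := by
        intro k'
        funext i
        rw [intCast_mulVec_apply, hvR, Matrix.mulVec_add, Matrix.mulVec_smul, Matrix.mulVec_smul]
        simp only [Pi.add_apply, Pi.smul_apply, smul_eq_mul, intCast_mulVec_apply]
      funext i
      have h := congrFun (key k) i
      have h' := congrFun (key K) i
      rw [e1, e2] at h
      exact_mod_cast h.trans h'.symm
    by_cases hnone : ∀ v : K3Index → ℤ,
        (∃ a b : ℝ, ∀ i, (v i : ℝ) = a * (x i).re + b * (x i).im) → v = 0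
    · -- no lattice vector in the plane: nothing to match
      refine ⟨0, Filter.Frequently.of_forall fun k v hv => ?_⟩
      rw [hnone v hv, Matrix.mulVec_zero, Matrix.mulVec_zero]
    · -- `P_x ∩ Λ_ℚ = ℚ v₀`: pigeonhole on `g_k v₀`, commensurability for the other vectors
      push Not at hnone
      obtain ⟨v₀, ⟨α, β, hv₀⟩, hv₀0⟩ := hnone
      obtain ⟨m, hm⟩ := eventually_latticeVector_mem_Icc hB hlim hy hD
        (B (fun i => (v₀ i : ℝ)) (fun i => (v₀ i : ℝ)))
      have hev : ∀ᶠ k in atTop, g k *ᵥ v₀ ∈ Set.pi Set.univ (fun _ : K3Index => Set.Icc (-m) m) := by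
        filter_upwards [hm] with k hk
        exact fun i _ => hk _ α β (hco k v₀ α β hv₀) (hQ v₀ k).le i
      obtain ⟨w₀, -, hfr⟩ := exists_frequently_eq_of_eventually_mem
        (Set.Finite.pi fun _ => Set.finite_Icc (-m) m) hev
      obtain ⟨K, hK⟩ := hfr.exists
      refine ⟨K, hfr.mono fun k hk v hv => ?_⟩
      obtain ⟨a₀, b₀, hv⟩ := hv
      obtain ⟨m', n, hn, hmn⟩ := exists_smul_eq_smul_of_not_rationalPlane hv₀0 hv₀ hv hrat
      have hj : ∀ j, n * v j = m' * v₀ j := fun j => by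
        have h := congrFun hmn j
        simp only [Pi.smul_apply, smul_eq_mul] at h
        exact h
      -- `n (g v)_i = m' (g v₀)_i` for every integral `g`
      have hmul : ∀ (M : Matrix K3Index K3Index ℤ) (i : K3Index),
          n * (M *ᵥ v) i = m' * (M *ᵥ v₀) i := fun M i => by
        simp only [Matrix.mulVec, dotProduct, Finset.mul_sum]
        refine Finset.sum_congr rfl fun j _ => ?_
        rw [mul_left_comm, hj j]
        ring
      funext i
      apply mul_left_cancel₀ hn
      rw [hmul (g k) i, hmul (g K) i, hk, hK]
  obtain ⟨K, hfrK⟩ := hK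
  refine ⟨g K, hg K, hdet K, fun v a b hv => ?_⟩
  -- frequently `g_K v = g_k v = a Re y_k + b Im y_k`, a closed condition in `y_k → y`
  have hcont : Continuous fun z : K3Index → ℂ => fun i => a * (z i).re + b * (z i).im :=
    continuous_pi fun i => (continuous_const.mul (Complex.continuous_re.comp (continuous_apply i))).add
      (continuous_const.mul (Complex.continuous_im.comp (continuous_apply i)))
  have hclosed : IsClosed {z : K3Index → ℂ |
      (fun i => a * (z i).re + b * (z i).im) = fun i => ((g K *ᵥ v) i : ℝ)} :=
    isClosed_eq hcont continuous_const
  have hfr : ∃ᶠ k in atTop, yk k ∈ {z : K3Index → ℂ |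
      (fun i => a * (z i).re + b * (z i).im) = fun i => ((g K *ᵥ v) i : ℝ)} :=
    hfrK.mono fun k hk => funext fun i => by
      rw [← hk v ⟨a, b, hv⟩]
      exact (hco k v a b hv i).symm
  have hmem := hclosed.mem_of_frequently_of_tendsto hfr hlim
  exact fun i => (congrFun hmem i).symm

/-- **Under the frame statement the orbit closure IS `Γ·T_x`.** Assuming `hframe` (NOT proved
here; Ratner's theorem), for every period vector `x` the closure of `SO(Λ_{K3})·x` in `Λ_ℂ` is
exactly the set of period vectors `y` with `(Re y)² = (Re x)²` for which some `γ ∈ SO(Λ_{K3})`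
carries every lattice vector of `P_x` to a lattice vector of `P_y` with the same coordinates —
`cl(Γ·x) = Γ·P_x·x`, the orbit-closure formula of Ratner's theorem for `H = SO⁺(1,19)` acting on
`SO(3,19)/SO(Λ_{K3})` with intermediate group `S_x ⊇ P_x` (`= SO⁺(3,19)`, `Stab(v)°`,
resp. `H` or `H·SO(2)` in the three cases). The inclusion `⊆` is unconditional
(`exists_orbit_frame_of_mem_closure_orbit`, `mem_k3PeriodDomain_of_mem_closure_orbit`); `⊇`
applies `hframe` to `γ x` (using `γ⁻¹ = adj γ ∈ SO(Λ_{K3})`) and `cl(Γ·γx) ⊆ cl(Γ·x)`.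
[cite: Verbitsky2017ErgodicErratum, §2.3 Theorem (i)–(iii) and its proof, §2.2 Theorem] -/
theorem closure_orbit_eq_of_frameOrbitClosure
    (hframe : ∀ x : K3Index → ℂ, x ∈ k3PeriodDomain → ∀ y : K3Index → ℂ, y ∈ k3PeriodDomain →
      Matrix.toBilin' (k3Gram.map (Int.cast : ℤ → ℝ)) (fun i => (y i).re) (fun i => (y i).re) =
        Matrix.toBilin' (k3Gram.map (Int.cast : ℤ → ℝ)) (fun i => (x i).re) (fun i => (x i).re) →
      (∀ (v : K3Index → ℤ) (a b : ℝ), (∀ i, (v i : ℝ) = a * (x i).re + b * (x i).im) →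
        ∀ i, (v i : ℝ) = a * (y i).re + b * (y i).im) →
      y ∈ closure {z : K3Index → ℂ | ∃ g : Matrix K3Index K3Index ℤ,
        g.transpose * k3Gram * g = k3Gram ∧ g.det = 1 ∧ z = g.map (Int.cast : ℤ → ℂ) *ᵥ x})
    {x : K3Index → ℂ} (hx : x ∈ k3PeriodDomain) :
    closure {z : K3Index → ℂ | ∃ g : Matrix K3Index K3Index ℤ,
      g.transpose * k3Gram * g = k3Gram ∧ g.det = 1 ∧ z = g.map (Int.cast : ℤ → ℂ) *ᵥ x} =
    {y : K3Index → ℂ | y ∈ k3PeriodDomain ∧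
      Matrix.toBilin' (k3Gram.map (Int.cast : ℤ → ℝ)) (fun i => (y i).re) (fun i => (y i).re) =
        Matrix.toBilin' (k3Gram.map (Int.cast : ℤ → ℝ)) (fun i => (x i).re) (fun i => (x i).re) ∧
      ∃ γ : Matrix K3Index K3Index ℤ, γ.transpose * k3Gram * γ = k3Gram ∧ γ.det = 1 ∧
        ∀ (v : K3Index → ℤ) (a b : ℝ), (∀ i, (v i : ℝ) = a * (x i).re + b * (x i).im) →
          ∀ i, ((γ *ᵥ v) i : ℝ) = a * (y i).re + b * (y i).im} := by
  set B := Matrix.toBilin' (k3Gram.map (Int.cast : ℤ → ℝ)) with hB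
  apply Set.Subset.antisymm
  · intro y hcl
    obtain ⟨hy, hsize⟩ := mem_k3PeriodDomain_of_mem_closure_orbit hx hcl
    exact ⟨hy, hsize, exists_orbit_frame_of_mem_closure_orbit hx hcl⟩
  · rintro y ⟨hy, hsize, γ, hγ, hγdet, hco⟩
    have hmap : ∀ g g' : Matrix K3Index K3Index ℤ,
        (g * g').map (Int.cast : ℤ → ℂ) = g.map (Int.cast : ℤ → ℂ) * g'.map (Int.cast : ℤ → ℂ) :=
      fun g g' => by
        have h := (Matrix.map_mul (L := g) (M := g') (f := Int.castRingHom ℂ))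
        simpa using h
    -- the inverse `γ' = adj γ ∈ SO(Λ_{K3})`
    set γ' : Matrix K3Index K3Index ℤ := γ.adjugate with hγ'
    have h1 : γ * γ' = 1 := by rw [hγ', Matrix.mul_adjugate, hγdet, one_smul]
    have h2 : γ' * γ = 1 := by rw [hγ', Matrix.adjugate_mul, hγdet, one_smul]
    -- the translate `γ x ∈ D`, of the same size
    have hx' : γ.map (Int.cast : ℤ → ℂ) *ᵥ x ∈ k3PeriodDomain := by
      have h := smul_map_mulVec_mem_k3PeriodDomain hx hγ one_ne_zero
      rwa [one_smul] at h
    have er : (fun i => ((γ.map (Int.cast : ℤ → ℂ) *ᵥ x) i).re) =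
        γ.map (Int.cast : ℤ → ℝ) *ᵥ fun j => (x j).re := funext fun i => re_map_mulVec γ x i
    have hsize' : B (fun i => (y i).re) (fun i => (y i).re) =
        B (fun i => ((γ.map (Int.cast : ℤ → ℂ) *ᵥ x) i).re)
          (fun i => ((γ.map (Int.cast : ℤ → ℂ) *ᵥ x) i).re) := by
      rw [hsize, er, k3RForm_mulVec_mulVec hB hγ]
    -- lattice vectors of `P_{γx}` are `γ` of lattice vectors of `P_x`, with the same coordinates
    have hco' : ∀ (u : K3Index → ℤ) (a b : ℝ),
        (∀ i, (u i : ℝ) = a * ((γ.map (Int.cast : ℤ → ℂ) *ᵥ x) i).re +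
          b * ((γ.map (Int.cast : ℤ → ℂ) *ᵥ x) i).im) →
        ∀ i, (u i : ℝ) = a * (y i).re + b * (y i).im := by
      intro u a b hu
      have hu' : ∀ i, ((γ' *ᵥ u) i : ℝ) = a * (x i).re + b * (x i).im := fun i => by
        have h := intCast_mulVec_eq_of_inPlane hu γ' i
        rwa [Matrix.mulVec_mulVec, ← hmap, h2,
          Matrix.map_one (Int.cast : ℤ → ℂ) Int.cast_zero Int.cast_one, Matrix.one_mulVec] at h
      have h := hco (γ' *ᵥ u) a b hu'
      rw [Matrix.mulVec_mulVec, h1, Matrix.one_mulVec] at h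
      exact h
    have hcl := hframe _ hx' y hy hsize' hco'
    refine closure_mono ?_ hcl
    rintro z ⟨g', hg', hdet', rfl⟩
    refine ⟨g' * γ, ?_, ?_, ?_⟩
    · calc (g' * γ).transpose * k3Gram * (g' * γ)
          = γ.transpose * (g'.transpose * k3Gram * g') * γ := by
            rw [Matrix.transpose_mul]; simp only [Matrix.mul_assoc]
        _ = k3Gram := by rw [hg', hγ]
    · rw [Matrix.det_mul, hdet', hγdet, mul_one]
    · rw [hmap, ← Matrix.mulVec_mulVec]

/-- **The frame statement is equivalent to the orbit-closure formula `cl(Γ·x) = Γ·T_x` for all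
period vectors `x`** (`⇒`: `closure_orbit_eq_of_frameOrbitClosure`; `⇐`: `T_x ⊆ Γ·T_x` with
`γ = 1`). So the residual input of `Verbitsky2017_orbitClosure_trichotomy_K3_holds` is exactly
Ratner's orbit-closure formula for `SO(Λ_{K3})` acting on conformal positive frames of `Λ_ℝ`.
[cite: Verbitsky2017ErgodicErratum, §2.3 Theorem (i)–(iii) and its proof, §2.2 Theorem] -/
theorem frameOrbitClosure_iff_closure_orbit_eq :
    (∀ x : K3Index → ℂ, x ∈ k3PeriodDomain → ∀ y : K3Index → ℂ, y ∈ k3PeriodDomain →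
      Matrix.toBilin' (k3Gram.map (Int.cast : ℤ → ℝ)) (fun i => (y i).re) (fun i => (y i).re) =
        Matrix.toBilin' (k3Gram.map (Int.cast : ℤ → ℝ)) (fun i => (x i).re) (fun i => (x i).re) →
      (∀ (v : K3Index → ℤ) (a b : ℝ), (∀ i, (v i : ℝ) = a * (x i).re + b * (x i).im) →
        ∀ i, (v i : ℝ) = a * (y i).re + b * (y i).im) →
      y ∈ closure {z : K3Index → ℂ | ∃ g : Matrix K3Index K3Index ℤ,
        g.transpose * k3Gram * g = k3Gram ∧ g.det = 1 ∧ z = g.map (Int.cast : ℤ → ℂ) *ᵥ x}) ↔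
    ∀ x : K3Index → ℂ, x ∈ k3PeriodDomain →
      closure {z : K3Index → ℂ | ∃ g : Matrix K3Index K3Index ℤ,
        g.transpose * k3Gram * g = k3Gram ∧ g.det = 1 ∧ z = g.map (Int.cast : ℤ → ℂ) *ᵥ x} =
      {y : K3Index → ℂ | y ∈ k3PeriodDomain ∧
        Matrix.toBilin' (k3Gram.map (Int.cast : ℤ → ℝ)) (fun i => (y i).re) (fun i => (y i).re) =
          Matrix.toBilin' (k3Gram.map (Int.cast : ℤ → ℝ)) (fun i => (x i).re) (fun i => (x i).re) ∧
        ∃ γ : Matrix K3Index K3Index ℤ, γ.transpose * k3Gram * γ = k3Gram ∧ γ.det = 1 ∧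
          ∀ (v : K3Index → ℤ) (a b : ℝ), (∀ i, (v i : ℝ) = a * (x i).re + b * (x i).im) →
            ∀ i, ((γ *ᵥ v) i : ℝ) = a * (y i).re + b * (y i).im} := by
  refine ⟨fun hframe x hx => closure_orbit_eq_of_frameOrbitClosure hframe hx, fun heq => ?_⟩
  intro x hx y hy hsize hco
  rw [heq x hx]
  refine ⟨hy, hsize, 1, by simp, Matrix.det_one, fun v a b hv i => ?_⟩
  rw [Matrix.one_mulVec]
  exact hco v a b hv i

/-! ### Orbit-map bookkeeping: closures in the group give closures of the orbit -/

/-- **From the group to the orbit.** If a real matrix `p` is a limit of products `γ h` with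
`γ ∈ SO(Λ_{K3})` and `h` a real matrix fixing the period vector `x` (e.g. `h` in the stabiliser
`H` of the frame `(Re x, Im x)`), then `p x` lies in the closure of the `SO(Λ_{K3})`-orbit of `x`:
the orbit map `m ↦ m x` is continuous and sends `γ h` to `γ x`. This is the (only) step from
Ratner's conclusion `cl(Γ H) = Γ S ⊇ S` in the group `G = SO(Λ ⊗ ℝ)` to the frame statement
`S·x ⊆ cl(Γ·x)` (`hframe` of `Verbitsky2017_orbitClosure_trichotomy_K3_of_frameOrbitClosure`).
[folklore] -/
theorem mulVec_mem_closure_orbit_of_mem_closure {x : K3Index → ℂ} {p : Matrix K3Index K3Index ℝ}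
    (hp : p ∈ closure {m : Matrix K3Index K3Index ℝ |
      ∃ (g : Matrix K3Index K3Index ℤ) (h : Matrix K3Index K3Index ℝ),
        g.transpose * k3Gram * g = k3Gram ∧ g.det = 1 ∧
        h.map ((↑) : ℝ → ℂ) *ᵥ x = x ∧ m = g.map (Int.cast : ℤ → ℝ) * h}) :
    p.map ((↑) : ℝ → ℂ) *ᵥ x ∈ closure {z : K3Index → ℂ | ∃ g : Matrix K3Index K3Index ℤ,
      g.transpose * k3Gram * g = k3Gram ∧ g.det = 1 ∧ z = g.map (Int.cast : ℤ → ℂ) *ᵥ x} := by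
  -- the orbit map is continuous
  set F : Matrix K3Index K3Index ℝ → (K3Index → ℂ) := fun m => m.map ((↑) : ℝ → ℂ) *ᵥ x with hF
  have hFc : Continuous F := by
    refine Continuous.matrix_mulVec ?_ continuous_const
    exact continuous_id.matrix_map Complex.continuous_ofReal
  have himage : F '' {m : Matrix K3Index K3Index ℝ |
      ∃ (g : Matrix K3Index K3Index ℤ) (h : Matrix K3Index K3Index ℝ),
        g.transpose * k3Gram * g = k3Gram ∧ g.det = 1 ∧
        h.map ((↑) : ℝ → ℂ) *ᵥ x = x ∧ m = g.map (Int.cast : ℤ → ℝ) * h} ⊆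
      {z : K3Index → ℂ | ∃ g : Matrix K3Index K3Index ℤ,
        g.transpose * k3Gram * g = k3Gram ∧ g.det = 1 ∧ z = g.map (Int.cast : ℤ → ℂ) *ᵥ x} := by
    rintro _ ⟨m, ⟨g, h, hg, hdet, hhx, rfl⟩, rfl⟩
    refine ⟨g, hg, hdet, ?_⟩
    have hmap : (g.map (Int.cast : ℤ → ℝ) * h).map ((↑) : ℝ → ℂ) =
        g.map (Int.cast : ℤ → ℂ) * h.map ((↑) : ℝ → ℂ) := by
      have hco : ((↑) : ℝ → ℂ) = (Complex.ofRealHom : ℝ → ℂ) := by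
        funext r; rfl
      rw [hco, Matrix.map_mul, Matrix.map_map]
      rfl
    simp only [hF, hmap, ← Matrix.mulVec_mulVec, hhx]
  have h1 : F p ∈ closure (F '' _) := image_closure_subset_closure_image hFc ⟨p, hp, rfl⟩
  exact closure_mono himage h1


end Literature.Dynamics.Homogeneous

end
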